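import Mathlib.Analysis.SpecialFunctions.Pow.Integral
import Mathlib.MeasureTheory.Function.ContinuousMapDense
import Mathlib.MeasureTheory.Function.LpSpace.Complete
import Literature.Analysis.FluidPDE.TsaiSelfSimilarPressureProofs
import Literature.Analysis.FluidPDE.NormalisedPressureL2Bound
import Literature.Analysis.FluidPDE.PressureRepresentation
import Literature.Analysis.FluidPDE.NormalisedPressurePowerWeightBound
import Literature.Analysis.FluidPDE.NormalisedPressureLpBound
import Literature.Analysis.FluidPDE.NormalisedPressureCompactSupport
import Literature.Analysis.FluidPDE.NormalisedPressurePowerWeightBoundProofs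
import HarnessLib

/-!
# Tsai's weighted Riesz-transform pressure from the `A_p` bound on test fields, proved

Analysis/FluidPDE proofs file for the named fact
`Literature.Analysis.FluidPDE.tsai1998_weightedRieszPressure` (`FluidPDE/TsaiWeightedRieszPressure`;
T.-P. Tsai, *On Leray's self-similar solutions of the Navier–Stokes equations satisfying local
energy estimates*, Arch. Rational Mech. Anal. 143 (1998) 29–51, §4 p. 45: for `U` with
(4.3) `∫ |U|^{10/3}|y|^{-5/3} < ∞` there is `P̃ ∈ L^{5/3}(|y|^{-5/3} dy)` with
`‖P̃‖ ≤ C Σ‖UᵢUⱼ‖` solving `−ΔP̃ = ∂ᵢ∂ⱼ(UᵢUⱼ)` in `𝒟'`), itself the harmonic-analysis leaf of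
`Literature.Analysis.FluidPDE.tsai1998_pressure_L53w` (reduced to it in
`FluidPDE/TsaiSelfSimilarPressureProofs`).

Tsai's sentence combines a theorem of weighted Calderón–Zygmund theory — `RᵢRⱼ` is bounded on
`L^{5/3}_w`, `w = |y|^{-5/3} ∈ A_{5/3}` ("[St2, pp. 204–211]") — with an elementary extension
argument ("(2.5) can be established for `U ∈ C_c^∞` … We then extend this result to general `U`
… by approximation", proof of Lemma 2.1, p. 34). The theorem is the named fact
`grafakos2014_normalisedPressure_powerWeight_bound` (`FluidPDE/NormalisedPressurePowerWeightBound`: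
`‖p̃[w]‖_{L^p(|x|^β)} ≤ C ‖|w|²‖_{L^p(|x|^β)}` for test fields `w`, `1 < p < ∞`,
`-3 < β < 3(p-1)`; Grafakos 2014 Thm 7.4.6 + Ex. 7.1.7). **This file proves the extension
argument**, i.e.

  `tsai1998_weightedRieszPressure_of_powerWeight :
     grafakos2014_normalisedPressure_powerWeight_bound → tsai1998_weightedRieszPressure`,

and hence `tsai1998_pressure_L53w_of_powerWeight`: the whole of Tsai's pp. 45–46 now rests on
the single `A_p` statement on test fields. As a by-product the unweighted sibling
`stein1970_normalisedPressure_Lp_bound` is the case `β = 0` (`…_of_powerWeight`).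

## The proof

* §1 The measures `|x|^β dx` on `ℝ³` (`β > -3`): `∫ f d(|x|^β dx) = ∫ f |x|^β dx`, the `eLpNorm`
  formula, local finiteness (Mathlib's `integrableOn_ball_of_norm_le_rpow`), hence regularity.
* §2 Polarisation: the pressure kernel `K(z)(v)` and the local term `−|v|²/3` are quadratic
  forms in `v`, so `p̃[tu + t⁻¹v] − p̃[tu − t⁻¹v] = p̃[u+v] − p̃[u−v]` for test fields (through the
  truncated integrals and the principal values of `hasPressurePV_of_hasCompactSupport`).
* §3 With the `2`-homogeneity `p̃[cw] = c²p̃[w]`: `p̃[u] − p̃[v] = ¼(p̃[tf+t⁻¹g] − p̃[tf−t⁻¹g])`,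
  `f = u − v`, `g = u + v`, whence the **bilinear estimate**
  `‖p̃[u] − p̃[v]‖_p ≤ 4C (t²‖|u−v|²‖_p + t⁻²‖|u+v|²‖_p)` for every `t > 0`.
* §4 (2.5) for test fields: `∫ p̃[w] Δφ = −∫ D²φ(w,w)` — the tree's weak pressure Poisson
  equation for compactly supported smooth fields (`FluidPDE/NormalisedPressureCompactSupport`).
* §5 Approximation: a continuous `U ∈ L^{10/3}(|x|^{-5/3})` is the limit of test fields `wₙ`
  (`C_c` is dense for the Radon measure, Mathlib `MemLp.exists_hasCompactSupport_eLpNorm_sub_le`;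
  mollification with `ContDiffBump.dist_normed_convolution_le`).
* §6 `p̃[wₙ]` is Cauchy in `L^{5/3}(|x|^{-5/3})` (§3 with `‖wₙ − wₘ‖ → 0`, `‖wₙ + wₘ‖` bounded: first
  `t → ∞`, then `n, m → ∞`) and converges to some `P̃` (completeness of Mathlib's `Lp`).
* §7 Both pairings pass to the limit: `∫ p̃[wₙ]ψ → ∫ P̃ψ` (weighted Hölder on the ball carrying
  `supp ψ`, `lintegral_enorm_closedBall_le_weighted` of `TsaiSelfSimilarPressureProofs`) and
  `∫ D²φ(wₙ,wₙ) → ∫ D²φ(U,U)` (Cauchy–Schwarz on the ball and the weighted control of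
  `∫_{B_R}|f|²`).
* §8 Assembly: `P̃` is a.e.-strongly measurable for Lebesgue measure (the density never
  vanishes), `‖P̃‖_{5/3,w} ≤ C ‖U‖²_{10/3,w}` in the limit, i.e.
  `∫ |P̃|^{5/3} w ≤ C^{5/3} ∫ |U|^{10/3} w`, and `∫ P̃ Δφ = −∫ D²φ(U,U)`.

## Mathlib / tree tools

Mathlib: `Measure.withDensity`, `lintegral_withDensity_eq_lintegral_mul_non_measurable`,
`ae_withDensity_iff`, `integrableOn_ball_of_norm_le_rpow`,
`MemLp.exists_hasCompactSupport_eLpNorm_sub_le`, `ContDiffBump.dist_normed_convolution_le`,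
`HasCompactSupport.uniformContinuous_of_continuous`, `Lp` completeness
(`cauchySeq_tendsto_of_complete`, `Lp.tendsto_Lp_iff_tendsto_eLpNorm'`), `eLpNorm_norm_rpow`,
`ENNReal.lintegral_mul_le_Lp_mul_Lq`. Tree: `normalisedPressure`, `pressureKernel`,
`HasPressurePV`, `normalisedPressure_smul` (`NormalisedPressure`);
`hasPressurePV_of_hasCompactSupport` (`NormalisedPressureL2Bound`);
`continuous_normalisedPressure_of_hasCompactSupport`, `integral_normalisedPressure_mul_laplacian`
(`NormalisedPressureCompactSupport`); `lintegral_enorm_closedBall_le_weighted`,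
`setIntegral_norm_closedBall_le_weighted`, `locallyIntegrable_of_weighted`,
`abs_integral_le_of_bound_closedBall` (`TsaiSelfSimilarPressureProofs`).

## References

* T.-P. Tsai, *On Leray's self-similar solutions of the Navier–Stokes equations satisfying local
  energy estimates*, Arch. Rational Mech. Anal. 143 (1998): Lemma 2.1 and its proof, (2.2),
  (2.5) (p. 34); §4, (4.3) and p. 45 [Tsai1998].
* L. Grafakos, *Classical Fourier Analysis*, 3rd ed. (2014), Thm 7.4.6, Example 7.1.6,
  Example 7.1.7 [Grafakos2014].
* E. M. Stein, *Harmonic Analysis* (1993), Ch. V §4.2, §6.4 [SteinHA1993].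
* T. Tao, *Localisation and compactness properties of the Navier–Stokes global regularity
  problem*, arXiv:1108.1165, (35), (42) (the normalised pressure) [Tao2011].
-/

noncomputable section

open MeasureTheory Set Filter Metric Topology InnerProductSpace Function
open scoped ENNReal NNReal RealInnerProductSpace ContDiff Laplacian

namespace Literature.Analysis.FluidPDE

/-- Local notation for physical space `ℝ³ = EuclideanSpace ℝ (Fin 3)`. -/
local notation "ℝ³" => EuclideanSpace ℝ (Fin 3)

/-! ## §1. The power-weighted measures `|x|^β dx` on `ℝ³` -/

section WeightedMeasure

/-- The power weight `x ↦ |x|^β` (in `ℝ≥0∞`) is measurable. [folklore] -/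
theorem measurable_enorm_rpow (β : ℝ) : Measurable fun x : ℝ³ => ‖x‖ₑ ^ β :=
  measurable_enorm.pow_const β

/-- The power weight is finite off the origin, hence a.e. [folklore] -/
theorem ae_enorm_rpow_lt_top (β : ℝ) : ∀ᵐ x ∂(volume : Measure ℝ³), ‖x‖ₑ ^ β < ⊤ := by
  have : ({(0 : ℝ³)} : Set ℝ³)ᶜ ∈ ae (volume : Measure ℝ³) :=
    compl_mem_ae_iff.2 (measure_singleton _)
  filter_upwards [this] with x hx
  have hx0 : x ≠ 0 := by simpa using hx
  rw [enorm_rpow_eq_ofReal_normRpow hx0]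
  exact ENNReal.ofReal_lt_top

/-- Integration against `|x|^β dx` is integration of `|x|^β f` against Lebesgue measure (no
measurability needed, the weight being a.e. finite). [folklore] -/
theorem lintegral_withDensity_enorm_rpow (β : ℝ) (g : ℝ³ → ℝ≥0∞) :
    ∫⁻ x, g x ∂(volume.withDensity fun x : ℝ³ => ‖x‖ₑ ^ β) = ∫⁻ x, g x * ‖x‖ₑ ^ β := by
  rw [lintegral_withDensity_eq_lintegral_mul_non_measurable _ (measurable_enorm_rpow β)
    (ae_enorm_rpow_lt_top β)]
  exact lintegral_congr fun x => by simp [mul_comm]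

/-- The `L^p(|x|^β dx)` seminorm in terms of the weighted Lebesgue integral:
`‖f‖_{L^p(|x|^β)} = (∫ |f|^p |x|^β)^{1/p}` (`0 < p < ∞`). [folklore] -/
theorem eLpNorm_withDensity_enorm_rpow {G : Type*} [NormedAddCommGroup G] (f : ℝ³ → G) (β : ℝ)
    {p : ℝ≥0∞} (hp0 : p ≠ 0) (hptop : p ≠ ⊤) :
    eLpNorm f p (volume.withDensity fun x : ℝ³ => ‖x‖ₑ ^ β) =
      (∫⁻ x, ‖f x‖ₑ ^ p.toReal * ‖x‖ₑ ^ β) ^ (1 / p.toReal) := by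
  rw [eLpNorm_eq_lintegral_rpow_enorm_toReal hp0 hptop, lintegral_withDensity_enorm_rpow]

/-- **Power weights with `β > -3` are locally finite on `ℝ³`**: balls have finite
`|x|^β dx`-measure (Grafakos 2014, Example 7.1.6: `|x|^a dx` is a (doubling) Radon measure for
`a > -n`). [cite: Grafakos2014, Example 7.1.6] -/
theorem withDensity_enorm_rpow_ball_lt_top {β : ℝ} (hβ : -3 < β) (R : ℝ) :
    (volume.withDensity fun x : ℝ³ => ‖x‖ₑ ^ β) (ball (0 : ℝ³) R) < ⊤ := by
  rw [withDensity_apply _ measurableSet_ball]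
  have hint : IntegrableOn (fun x : ℝ³ => ‖x‖ ^ β) (ball (0 : ℝ³) R) := by
    refine integrableOn_ball_of_norm_le_rpow (μ := volume) (by simp)
      (C := 1) (α := -β) (by rw [finrank_euclideanSpace_fin]; push_cast; linarith)
      (ae_of_all _ fun x => ?_) (measurable_norm.pow_const β).aestronglyMeasurable
    rw [neg_neg, one_mul, Real.norm_of_nonneg (Real.rpow_nonneg (norm_nonneg _) _)]
  have h0 : ∀ᵐ x ∂(volume.restrict (ball (0 : ℝ³) R)), x ≠ (0 : ℝ³) := by
    refine ae_restrict_of_ae ?_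
    have : ({(0 : ℝ³)} : Set ℝ³)ᶜ ∈ ae (volume : Measure ℝ³) :=
      compl_mem_ae_iff.2 (measure_singleton _)
    filter_upwards [this] with x hx
    simpa using hx
  calc ∫⁻ x in ball (0 : ℝ³) R, ‖x‖ₑ ^ β = ∫⁻ x in ball (0 : ℝ³) R, ‖(‖x‖ ^ β)‖ₑ := by
        refine lintegral_congr_ae ?_
        filter_upwards [h0] with x hx
        rw [enorm_rpow_eq_ofReal_normRpow hx, Real.enorm_eq_ofReal (Real.rpow_nonneg (norm_nonneg _) _)]
    _ < ⊤ := hint.2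

/-- The weighted measure of a closed ball is finite (`β > -3`). [cite: Grafakos2014, Example 7.1.6] -/
theorem withDensity_enorm_rpow_closedBall_lt_top {β : ℝ} (hβ : -3 < β) (R : ℝ) :
    (volume.withDensity fun x : ℝ³ => ‖x‖ₑ ^ β) (closedBall (0 : ℝ³) R) < ⊤ :=
  (measure_mono (closedBall_subset_ball (lt_add_one R))).trans_lt
    (withDensity_enorm_rpow_ball_lt_top hβ (R + 1))

/-- `|x|^β dx`, `β > -3`, is a locally finite measure on `ℝ³` (hence regular, `ℝ³` being
`σ`-compact). [cite: Grafakos2014, Example 7.1.6] -/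
theorem isLocallyFiniteMeasure_withDensity_enorm_rpow {β : ℝ} (hβ : -3 < β) :
    IsLocallyFiniteMeasure (volume.withDensity fun x : ℝ³ => ‖x‖ₑ ^ β) := by
  refine ⟨fun x => ⟨ball (0 : ℝ³) (‖x‖ + 1), ?_, withDensity_enorm_rpow_ball_lt_top hβ _⟩⟩
  exact isOpen_ball.mem_nhds (mem_ball_zero_iff.2 (lt_add_one _))

end WeightedMeasure

/-! ## §2. The normalised pressure as a quadratic form: a polarisation identity -/

section Polarisation

/-- The algebraic heart of polarisation for the pressure kernel, a quadratic form in the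
velocity slot: `K(z)(ta + t⁻¹b) − K(z)(ta − t⁻¹b) = K(z)(a + b) − K(z)(a − b)` (`t ≠ 0`).
[folklore] -/
theorem pressureKernel_polarisation (z a b : ℝ³) {t : ℝ} (ht : t ≠ 0) :
    pressureKernel z (t • a + t⁻¹ • b) - pressureKernel z (t • a - t⁻¹ • b) =
      pressureKernel z (a + b) - pressureKernel z (a - b) := by
  simp only [pressureKernel, inner_add_right, inner_sub_right, inner_smul_right,
    norm_add_sq_real, norm_sub_sq_real, norm_smul, inner_smul_left, inner_smul_right,
    Real.norm_eq_abs, mul_pow, sq_abs, RCLike.conj_to_real]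
  rw [div_sub_div_same, div_sub_div_same]
  congr 1
  have h2 : t * t⁻¹ = 1 := mul_inv_cancel₀ ht
  linear_combination (4 * (Module.finrank ℝ ℝ³ : ℝ) * ⟪z, a⟫ * ⟪z, b⟫ - 4 * ‖z‖ ^ 2 * ⟪a, b⟫) * h2

/-- The same identity for the local term `-|v|²/3`. [folklore] -/
theorem norm_sq_polarisation (a b : ℝ³) {t : ℝ} (ht : t ≠ 0) :
    ‖t • a + t⁻¹ • b‖ ^ 2 - ‖t • a - t⁻¹ • b‖ ^ 2 = ‖a + b‖ ^ 2 - ‖a - b‖ ^ 2 := by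
  simp only [norm_add_sq_real, norm_sub_sq_real, norm_smul, inner_smul_left, inner_smul_right,
    Real.norm_eq_abs, mul_pow, sq_abs, RCLike.conj_to_real]
  have h2 : t * t⁻¹ = 1 := mul_inv_cancel₀ ht
  linear_combination (4 * ⟪a, b⟫) * h2

variable {u v : ℝ³ → ℝ³}

/-- Difference of truncated pressure integrals of two fields whose truncated integrands are
integrable. [folklore] -/
theorem truncatedPressureIntegral_sub_of_integrableOn {w₁ w₂ : ℝ³ → ℝ³} {x : ℝ³} {ε : ℝ}
    (h₁ : IntegrableOn (fun y => pressureKernel (x - y) (w₁ y)) (closedBall x ε)ᶜ)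
    (h₂ : IntegrableOn (fun y => pressureKernel (x - y) (w₂ y)) (closedBall x ε)ᶜ) :
    truncatedPressureIntegral w₁ x ε - truncatedPressureIntegral w₂ x ε =
      ∫ y in (closedBall x ε)ᶜ, (pressureKernel (x - y) (w₁ y) - pressureKernel (x - y) (w₂ y)) := by
  rw [truncatedPressureIntegral, truncatedPressureIntegral, ← integral_sub h₁ h₂]

/-- **Polarisation of the normalised pressure** (the quadratic map `w ↦ p̃[w]` comes from a
symmetric bilinear one): for test fields `u, v` and `t ≠ 0`,
`p̃[tu + t⁻¹v] − p̃[tu − t⁻¹v] = p̃[u + v] − p̃[u − v]` pointwise — both sides equal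
`4 B(u, v)` with `B` the polarised singular integral. Used with the `2`-homogeneity
`p̃[cw] = c² p̃[w]` to control differences `p̃[u] − p̃[v]`. [folklore] -/
theorem normalisedPressure_polarisation (hu : ContDiff ℝ ∞ u) (huc : HasCompactSupport u)
    (hv : ContDiff ℝ ∞ v) (hvc : HasCompactSupport v) {t : ℝ} (ht : t ≠ 0) (x : ℝ³) :
    normalisedPressure (t • u + t⁻¹ • v) x - normalisedPressure (t • u - t⁻¹ • v) x =
      normalisedPressure (u + v) x - normalisedPressure (u - v) x := by
  -- the four principal values
  have hs : ∀ (a b : ℝ), ContDiff ℝ ∞ (a • u + b • v) ∧ HasCompactSupport (a • u + b • v) :=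
    fun a b => ⟨(hu.const_smul a).add (hv.const_smul b),
      (huc.smul_left (f := fun _ => a)).add (hvc.smul_left (f := fun _ => b))⟩
  have e1 : t • u + t⁻¹ • v = t • u + t⁻¹ • v := rfl
  have e2 : t • u - t⁻¹ • v = t • u + (-t⁻¹) • v := by rw [neg_smul, sub_eq_add_neg]
  have e3 : u + v = (1 : ℝ) • u + (1 : ℝ) • v := by rw [one_smul, one_smul]
  have e4 : u - v = (1 : ℝ) • u + (-1 : ℝ) • v := by rw [one_smul, neg_smul, one_smul, sub_eq_add_neg]
  obtain ⟨L₁, hL₁⟩ : ∃ L, HasPressurePV (t • u + t⁻¹ • v) x L :=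
    ⟨_, hasPressurePV_of_hasCompactSupport (hs t t⁻¹).1 (hs t t⁻¹).2 x⟩
  obtain ⟨L₂, hL₂⟩ : ∃ L, HasPressurePV (t • u - t⁻¹ • v) x L := by
    rw [e2]; exact ⟨_, hasPressurePV_of_hasCompactSupport (hs t (-t⁻¹)).1 (hs t (-t⁻¹)).2 x⟩
  obtain ⟨L₃, hL₃⟩ : ∃ L, HasPressurePV (u + v) x L := by
    rw [e3]; exact ⟨_, hasPressurePV_of_hasCompactSupport (hs 1 1).1 (hs 1 1).2 x⟩
  obtain ⟨L₄, hL₄⟩ : ∃ L, HasPressurePV (u - v) x L := by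
    rw [e4]; exact ⟨_, hasPressurePV_of_hasCompactSupport (hs 1 (-1)).1 (hs 1 (-1)).2 x⟩
  rw [normalisedPressure_eq hL₁, normalisedPressure_eq hL₂, normalisedPressure_eq hL₃,
    normalisedPressure_eq hL₄, finrank_euclideanSpace_fin]
  -- the truncated integrals have the same differences, eventually in `ε`
  have hev : ∀ᶠ ε in 𝓝[>] (0 : ℝ),
      truncatedPressureIntegral (t • u + t⁻¹ • v) x ε - truncatedPressureIntegral (t • u - t⁻¹ • v) x ε =
        truncatedPressureIntegral (u + v) x ε - truncatedPressureIntegral (u - v) x ε := by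
    filter_upwards [hL₁.1, hL₂.1, hL₃.1, hL₄.1] with ε h1 h2 h3 h4
    rw [truncatedPressureIntegral_sub_of_integrableOn h1 h2,
      truncatedPressureIntegral_sub_of_integrableOn h3 h4]
    refine integral_congr_ae (ae_of_all _ fun y => ?_)
    simp only [Pi.add_apply, Pi.sub_apply, Pi.smul_apply]
    exact pressureKernel_polarisation _ _ _ ht
  have hlim : L₁ - L₂ = L₃ - L₄ :=
    tendsto_nhds_unique ((hL₁.2.sub hL₂.2).congr' hev) (hL₃.2.sub hL₄.2)
  have hloc := norm_sq_polarisation (u x) (v x) ht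
  simp only [Pi.add_apply, Pi.sub_apply, Pi.smul_apply] at hloc ⊢
  push_cast
  linarith

end Polarisation

/-! ## §3. Differences of normalised pressures under a weighted bound on test fields -/

section Difference

variable {u v : ℝ³ → ℝ³}

/-- `p̃[u] − p̃[v] = ¼ (p̃[(u−v)+(u+v)] − p̃[(u−v)−(u+v)])` by `2`-homogeneity. [folklore] -/
theorem normalisedPressure_sub_eq_quarter (u v : ℝ³ → ℝ³) (x : ℝ³) :
    normalisedPressure u x - normalisedPressure v x =
      4⁻¹ * (normalisedPressure ((u - v) + (u + v)) x - normalisedPressure ((u - v) - (u + v)) x) := by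
  have h1 : (u - v) + (u + v) = (2 : ℝ) • u := by
    funext y
    simp only [Pi.add_apply, Pi.sub_apply, Pi.smul_apply, two_smul]
    abel
  have h2 : (u - v) - (u + v) = (-2 : ℝ) • v := by
    funext y
    simp only [Pi.add_apply, Pi.sub_apply, Pi.smul_apply, neg_smul, two_smul]
    abel
  rw [h1, h2, normalisedPressure_smul, normalisedPressure_smul]
  ring

/-- Elementary: `‖ta + t⁻¹b‖² ≤ 2t²‖a‖² + 2t⁻²‖b‖²`. [folklore] -/
theorem norm_smul_add_smul_sq_le (a b : ℝ³) (t : ℝ) :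
    ‖t • a + t⁻¹ • b‖ ^ 2 ≤ 2 * t ^ 2 * ‖a‖ ^ 2 + 2 * t⁻¹ ^ 2 * ‖b‖ ^ 2 := by
  have h := norm_add_le (t • a) (t⁻¹ • b)
  rw [norm_smul, norm_smul, Real.norm_eq_abs, Real.norm_eq_abs] at h
  set X := |t| * ‖a‖ with hX
  set Y := |t⁻¹| * ‖b‖ with hY
  have hX0 : 0 ≤ X := by positivity
  have hY0 : 0 ≤ Y := by positivity
  have h1 : ‖t • a + t⁻¹ • b‖ ^ 2 ≤ (X + Y) ^ 2 := pow_le_pow_left₀ (norm_nonneg _) h 2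
  have h2 : (X + Y) ^ 2 ≤ 2 * X ^ 2 + 2 * Y ^ 2 := by
    have := two_mul_le_add_sq X Y
    nlinarith [this]
  have h3 : 2 * X ^ 2 + 2 * Y ^ 2 = 2 * t ^ 2 * ‖a‖ ^ 2 + 2 * t⁻¹ ^ 2 * ‖b‖ ^ 2 := by
    rw [hX, hY, mul_pow, mul_pow, sq_abs, sq_abs]; ring
  linarith

variable {μ : Measure ℝ³} {p : ℝ≥0∞} {C : ℝ≥0∞}

/-- The weighted bound transported to `tf + t⁻¹g`:
`‖ |tf + t⁻¹g|² ‖_p ≤ 2t² ‖|f|²‖_p + 2t⁻² ‖|g|²‖_p`. [folklore] -/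
theorem eLpNorm_norm_sq_smul_add_smul_le {f g : ℝ³ → ℝ³} (hf : Continuous f) (hg : Continuous g)
    (hp : 1 ≤ p) (t : ℝ) :
    eLpNorm (fun x => ‖(t • f + t⁻¹ • g) x‖ ^ 2) p μ ≤
      ENNReal.ofReal (2 * t ^ 2) * eLpNorm (fun x => ‖f x‖ ^ 2) p μ +
        ENNReal.ofReal (2 * t⁻¹ ^ 2) * eLpNorm (fun x => ‖g x‖ ^ 2) p μ := by
  have hF : AEStronglyMeasurable (fun x => 2 * t ^ 2 * ‖f x‖ ^ 2) μ :=
    (continuous_const.mul (hf.norm.pow 2)).aestronglyMeasurable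
  have hG : AEStronglyMeasurable (fun x => 2 * t⁻¹ ^ 2 * ‖g x‖ ^ 2) μ :=
    (continuous_const.mul (hg.norm.pow 2)).aestronglyMeasurable
  have step1 : eLpNorm (fun x => ‖(t • f + t⁻¹ • g) x‖ ^ 2) p μ ≤
      eLpNorm (fun x => 2 * t ^ 2 * ‖f x‖ ^ 2 + 2 * t⁻¹ ^ 2 * ‖g x‖ ^ 2) p μ := by
    refine eLpNorm_mono fun x => ?_
    have e : (t • f + t⁻¹ • g) x = t • f x + t⁻¹ • g x := rfl
    rw [e, Real.norm_of_nonneg (sq_nonneg _), Real.norm_of_nonneg (by positivity)]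
    exact norm_smul_add_smul_sq_le (f x) (g x) t
  have step2 := eLpNorm_add_le hF hG hp
  have e1 : (fun x => 2 * t ^ 2 * ‖f x‖ ^ 2) = (2 * t ^ 2) • fun x => ‖f x‖ ^ 2 := by
    funext x; simp only [Pi.smul_apply, smul_eq_mul]
  have e2 : (fun x => 2 * t⁻¹ ^ 2 * ‖g x‖ ^ 2) = (2 * t⁻¹ ^ 2) • fun x => ‖g x‖ ^ 2 := by
    funext x; simp only [Pi.smul_apply, smul_eq_mul]
  have h2t : (0 : ℝ) ≤ 2 * t ^ 2 := by positivity
  have h2t' : (0 : ℝ) ≤ 2 * t⁻¹ ^ 2 := by positivity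
  have step3 : eLpNorm (fun x => 2 * t ^ 2 * ‖f x‖ ^ 2) p μ =
      ENNReal.ofReal (2 * t ^ 2) * eLpNorm (fun x => ‖f x‖ ^ 2) p μ := by
    rw [e1, eLpNorm_const_smul, Real.enorm_eq_ofReal h2t]
  have step4 : eLpNorm (fun x => 2 * t⁻¹ ^ 2 * ‖g x‖ ^ 2) p μ =
      ENNReal.ofReal (2 * t⁻¹ ^ 2) * eLpNorm (fun x => ‖g x‖ ^ 2) p μ := by
    rw [e2, eLpNorm_const_smul, Real.enorm_eq_ofReal h2t']
  have e0 : (fun x => 2 * t ^ 2 * ‖f x‖ ^ 2 + 2 * t⁻¹ ^ 2 * ‖g x‖ ^ 2) =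
      (fun x => 2 * t ^ 2 * ‖f x‖ ^ 2) + fun x => 2 * t⁻¹ ^ 2 * ‖g x‖ ^ 2 := rfl
  rw [e0] at step1
  rw [← step3, ← step4]
  exact step1.trans step2

/-- **The bilinear estimate.** If the normalised pressure of test fields obeys a bound
`‖p̃[w]‖_{L^p(μ)} ≤ C ‖|w|²‖_{L^p(μ)}` (`1 ≤ p`), then for test fields `u, v` and every `t > 0`,
`‖p̃[u] − p̃[v]‖_{L^p(μ)} ≤ 4C (t² ‖|u − v|²‖ + t⁻² ‖|u + v|²‖)` — polarisation plus the scaling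
`(f, g) ↦ (tf, t⁻¹g)`; this is what makes `w ↦ p̃[w]` uniformly continuous on bounded sets of
`L^{2p}(μ)` and lets it extend from test fields (Tsai 1998, p. 34: "We then extend this result
to general `U ∈ L^q` by approximation"). [cite: Tsai1998, Lemma 2.1 proof (p. 34)] -/
theorem eLpNorm_normalisedPressure_sub_le [OpensMeasurableSpace ℝ³]
    (hC : ∀ w : ℝ³ → ℝ³, ContDiff ℝ ∞ w → HasCompactSupport w →
      eLpNorm (normalisedPressure w) p μ ≤ C * eLpNorm (fun x => ‖w x‖ ^ 2) p μ)
    (hp : 1 ≤ p) (hu : ContDiff ℝ ∞ u) (huc : HasCompactSupport u) (hv : ContDiff ℝ ∞ v)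
    (hvc : HasCompactSupport v) {t : ℝ} (ht : 0 < t) :
    eLpNorm (normalisedPressure u - normalisedPressure v) p μ ≤
      4 * C * (ENNReal.ofReal (t ^ 2) * eLpNorm (fun x => ‖(u - v) x‖ ^ 2) p μ +
        ENNReal.ofReal (t⁻¹ ^ 2) * eLpNorm (fun x => ‖(u + v) x‖ ^ 2) p μ) := by
  set f : ℝ³ → ℝ³ := u - v with hf_def
  set g : ℝ³ → ℝ³ := u + v with hg_def
  have hf : ContDiff ℝ ∞ f := hu.sub hv
  have hg : ContDiff ℝ ∞ g := hu.add hv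
  have hfc : HasCompactSupport f := huc.sub hvc
  have hgc : HasCompactSupport g := huc.add hvc
  -- the test fields `tf ± t⁻¹g`
  have hA : ContDiff ℝ ∞ (t • f + t⁻¹ • g) := (hf.const_smul t).add (hg.const_smul t⁻¹)
  have hB : ContDiff ℝ ∞ (t • f - t⁻¹ • g) := (hf.const_smul t).sub (hg.const_smul t⁻¹)
  have hAc : HasCompactSupport (t • f + t⁻¹ • g) :=
    (hfc.smul_left (f := fun _ => t)).add (hgc.smul_left (f := fun _ => t⁻¹))
  have hBc : HasCompactSupport (t • f - t⁻¹ • g) :=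
    (hfc.smul_left (f := fun _ => t)).sub (hgc.smul_left (f := fun _ => t⁻¹))
  -- `p̃[u] − p̃[v] = ¼ (p̃[tf + t⁻¹g] − p̃[tf − t⁻¹g])`
  have hptw : normalisedPressure u - normalisedPressure v =
      (4⁻¹ : ℝ) • (normalisedPressure (t • f + t⁻¹ • g) - normalisedPressure (t • f - t⁻¹ • g)) := by
    funext x
    simp only [Pi.sub_apply, Pi.smul_apply, smul_eq_mul]
    rw [normalisedPressure_sub_eq_quarter u v x,
      ← normalisedPressure_polarisation hf hfc hg hgc ht.ne' x]
  have hmA := (continuous_normalisedPressure_of_hasCompactSupport hA hAc).aestronglyMeasurable (μ := μ)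
  have hmB := (continuous_normalisedPressure_of_hasCompactSupport hB hBc).aestronglyMeasurable (μ := μ)
  have hquarter : ‖(4⁻¹ : ℝ)‖ₑ ≤ 1 := by
    rw [Real.enorm_eq_ofReal (by norm_num)]
    exact ENNReal.ofReal_le_one.2 (by norm_num)
  -- `t f - t⁻¹ g = t f + t⁻¹ (-g)` for the second application of the transport lemma
  have hBform : t • f - t⁻¹ • g = t • f + t⁻¹ • (-g) := by rw [smul_neg, sub_eq_add_neg]
  calc eLpNorm (normalisedPressure u - normalisedPressure v) p μ
      = ‖(4⁻¹ : ℝ)‖ₑ * eLpNorm (normalisedPressure (t • f + t⁻¹ • g) -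
          normalisedPressure (t • f - t⁻¹ • g)) p μ := by rw [hptw, eLpNorm_const_smul]
    _ ≤ 1 * (eLpNorm (normalisedPressure (t • f + t⁻¹ • g)) p μ +
          eLpNorm (normalisedPressure (t • f - t⁻¹ • g)) p μ) :=
        mul_le_mul' hquarter (eLpNorm_sub_le hmA hmB hp)
    _ ≤ 1 * (C * eLpNorm (fun x => ‖(t • f + t⁻¹ • g) x‖ ^ 2) p μ +
          C * eLpNorm (fun x => ‖(t • f - t⁻¹ • g) x‖ ^ 2) p μ) := by
        gcongr
        · exact hC _ hA hAc
        · exact hC _ hB hBc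
    _ ≤ 1 * (C * (ENNReal.ofReal (2 * t ^ 2) * eLpNorm (fun x => ‖f x‖ ^ 2) p μ +
            ENNReal.ofReal (2 * t⁻¹ ^ 2) * eLpNorm (fun x => ‖g x‖ ^ 2) p μ) +
          C * (ENNReal.ofReal (2 * t ^ 2) * eLpNorm (fun x => ‖f x‖ ^ 2) p μ +
            ENNReal.ofReal (2 * t⁻¹ ^ 2) * eLpNorm (fun x => ‖(-g) x‖ ^ 2) p μ)) := by
        gcongr
        · exact eLpNorm_norm_sq_smul_add_smul_le hf.continuous hg.continuous hp t
        · rw [hBform]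
          exact eLpNorm_norm_sq_smul_add_smul_le hf.continuous hg.continuous.neg hp t
    _ = 4 * C * (ENNReal.ofReal (t ^ 2) * eLpNorm (fun x => ‖f x‖ ^ 2) p μ +
          ENNReal.ofReal (t⁻¹ ^ 2) * eLpNorm (fun x => ‖g x‖ ^ 2) p μ) := by
        have e1 : (fun x => ‖(-g) x‖ ^ 2) = fun x => ‖g x‖ ^ 2 := by
          funext x; simp
        rw [e1, ENNReal.ofReal_mul (by norm_num), ENNReal.ofReal_mul (by norm_num),
          ENNReal.ofReal_ofNat]
        ring

end Difference

/-! ## §4. The distributional equation `−Δp̃[w] = ∂ᵢ∂ⱼ(wᵢwⱼ)` for test fields -/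

section Distributional

/-- **Tsai 1998, (2.5), for test fields**: `∫ p̃[w] Δφ = −∫ D²φ(w, w)` for `w ∈ C_c^∞(ℝ³; ℝ³)`
and `φ ∈ C_c^∞(ℝ³)` ("`RᵢRⱼ` are self-adjoint … `RᵢRⱼΔφ = −∂ᵢ∂ⱼφ` … (2.5) can be established
for `U ∈ C_c^∞`", p. 34) — the sign-flipped reading of the tree's weak pressure Poisson equation
`integral_normalisedPressure_mul_laplacian` (`FluidPDE/NormalisedPressureCompactSupport`).
[cite: Tsai1998, (2.5) (p. 34)] -/
theorem integral_normalisedPressure_mul_laplacian_eq_neg {w : ℝ³ → ℝ³} (hw : ContDiff ℝ ∞ w)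
    (hwc : HasCompactSupport w) {φ : ℝ³ → ℝ} (hφ : ContDiff ℝ (⊤ : ℕ∞) φ)
    (hφc : HasCompactSupport φ) :
    ∫ x, normalisedPressure w x * (Δ φ) x = -∫ x, fderiv ℝ (fderiv ℝ φ) x (w x) (w x) := by
  have h := integral_normalisedPressure_mul_laplacian hw hwc (contDiff_infty.1 hφ 2) hφc
  linarith

/-- The unweighted sibling recovered: `stein1970_normalisedPressure_Lp_bound` is the case `β = 0`
of `grafakos2014_normalisedPressure_powerWeight_bound` (`|x|⁰ dx = dx`). [cite: Grafakos2014, Thm 7.4.6 and Example 7.1.7] -/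
theorem stein1970_normalisedPressure_Lp_bound_of_powerWeight
    (h : grafakos2014_normalisedPressure_powerWeight_bound) : stein1970_normalisedPressure_Lp_bound := by
  intro p hp hp'
  have h3 : (0 : ℝ) < 3 * (p.toReal - 1) := by
    have : 1 < p.toReal := by
      have h := (ENNReal.toReal_lt_toReal ENNReal.one_ne_top hp'.ne).2 hp
      simpa using h
    linarith
  obtain ⟨C, hC⟩ := h p hp hp' 0 (by norm_num) h3
  refine ⟨C, fun w hw hwc => ?_⟩
  have h0 : (volume.withDensity fun x : ℝ³ => ‖x‖ₑ ^ (0 : ℝ)) = volume := by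
    simp only [ENNReal.rpow_zero]
    exact withDensity_one
  simpa only [h0] using hC w hw hwc

end Distributional

/-! ## §5. Approximation by test fields in `L^p(|x|^β dx)` -/

section Approximation

open scoped Convolution
open ContinuousLinearMap

variable {G : Type*} [NormedAddCommGroup G] [NormedSpace ℝ G] [CompleteSpace G]

/-- **Smoothing a continuous compactly supported function** costs little in `L^p(μ)` for a
measure finite on compact sets: given `ε`, some mollification `φ ⋆ g` is a test function
supported in the `1`-neighbourhood of `supp g` with `‖φ ⋆ g − g‖_{L^p(μ)} ≤ ε` (uniform
continuity of `g` and `ContDiffBump.dist_normed_convolution_le`). [folklore] -/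
theorem exists_smooth_eLpNorm_sub_le_of_hasCompactSupport {μ : Measure ℝ³} [IsLocallyFiniteMeasure μ]
    {p : ℝ≥0∞} (hp0 : p ≠ 0) (hp : p ≠ ⊤) {g : ℝ³ → G} (hg : Continuous g)
    (hgc : HasCompactSupport g) {ε : ℝ≥0∞} (hε : ε ≠ 0) :
    ∃ w : ℝ³ → G, ContDiff ℝ ∞ w ∧ HasCompactSupport w ∧ eLpNorm (w - g) p μ ≤ ε := by
  -- the compact set carrying all the differences, and its (finite) measure
  set K : Set ℝ³ := cthickening 1 (tsupport g) with hK_def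
  have hK : IsCompact K := hgc.isCompact.cthickening
  have hKm : MeasurableSet K := isClosed_cthickening.measurableSet
  have hμK : μ K < ⊤ := hK.measure_lt_top
  set M : ℝ≥0∞ := μ K ^ (1 / p.toReal) with hM_def
  have hM : M ≠ ⊤ := ENNReal.rpow_ne_top_of_nonneg (by positivity) hμK.ne
  -- the admissible uniform error `η`
  set δ : ℝ≥0∞ := min 1 (ε / (M + 1)) with hδ_def
  have hδtop : δ ≠ ⊤ := ne_top_of_le_ne_top ENNReal.one_ne_top (min_le_left _ _)
  have hδ0 : δ ≠ 0 := by
    refine (lt_min zero_lt_one (ENNReal.div_pos hε ?_)).ne'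
    exact ENNReal.add_ne_top.2 ⟨hM, ENNReal.one_ne_top⟩
  have hδM : δ * M ≤ ε := by
    calc δ * M ≤ ε / (M + 1) * (M + 1) := mul_le_mul' (min_le_right _ _) le_self_add
      _ = ε := ENNReal.div_mul_cancel (by simp) (ENNReal.add_ne_top.2 ⟨hM, ENNReal.one_ne_top⟩)
  set η : ℝ := δ.toReal with hη_def
  have hη0 : 0 < η := ENNReal.toReal_pos hδ0 hδtop
  have hηδ : ENNReal.ofReal η = δ := ENNReal.ofReal_toReal hδtop
  -- uniform continuity of `g`
  obtain ⟨ρ, hρ0, hρ⟩ := Metric.uniformContinuous_iff.1 (hgc.uniformContinuous_of_continuous hg) η hη0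
  set r : ℝ := min ρ 1 with hr_def
  have hr0 : 0 < r := lt_min hρ0 one_pos
  let φ : ContDiffBump (0 : ℝ³) := ⟨r / 2, r, half_pos hr0, half_lt_self hr0⟩
  set w : ℝ³ → G := φ.normed volume ⋆[lsmul ℝ ℝ, volume] g with hw_def
  have hgl : LocallyIntegrable g volume := hg.locallyIntegrable
  have hw : ContDiff ℝ ∞ w := φ.hasCompactSupport_normed.contDiff_convolution_left _ φ.contDiff_normed hgl
  have hwc : HasCompactSupport w := φ.hasCompactSupport_normed.convolution _ hgc
  -- pointwise closeness and support control
  have hclose : ∀ x, dist (w x) (g x) ≤ η := fun x =>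
    φ.dist_normed_convolution_le hg.aestronglyMeasurable fun y hy =>
      (hρ ((mem_ball.1 hy).trans_le (min_le_left _ _))).le
  have hsupp : ∀ x, x ∉ K → w x = 0 ∧ g x = 0 := by
    intro x hx
    have hgx : g x = 0 := image_eq_zero_of_notMem_tsupport fun h => hx (self_subset_cthickening _ h)
    refine ⟨?_, hgx⟩
    by_contra hwx
    obtain ⟨a, ha, b, hb, rfl⟩ := support_convolution_subset _ (mem_support.2 hwx)
    have ha' : ‖a‖ < r := by
      rw [φ.support_normed_eq] at ha
      exact mem_ball_zero_iff.1 ha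
    refine hx (mem_cthickening_of_dist_le (a + b) b 1 _ (subset_tsupport _ hb) ?_)
    rw [dist_eq_norm, add_sub_cancel_right]
    exact (ha'.trans_le (min_le_right _ _)).le
  -- the `L^p` bound through the indicator of `K`
  have hbound : ∀ x, ‖(w - g) x‖ ≤ ‖K.indicator (fun _ => η) x‖ := by
    intro x
    by_cases hx : x ∈ K
    · rw [indicator_of_mem hx, Real.norm_of_nonneg hη0.le, Pi.sub_apply, ← dist_eq_norm]
      exact hclose x
    · obtain ⟨h1, h2⟩ := hsupp x hx
      simp [h1, h2, indicator_of_notMem hx]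
  refine ⟨w, hw, hwc, ?_⟩
  calc eLpNorm (w - g) p μ ≤ eLpNorm (K.indicator fun _ => η) p μ := eLpNorm_mono hbound
    _ = ‖η‖ₑ * μ K ^ (1 / p.toReal) := eLpNorm_indicator_const hKm hp0 hp
    _ = δ * M := by rw [Real.enorm_eq_ofReal hη0.le, hηδ]
    _ ≤ ε := hδM

/-- **Test fields are dense in `L^p(|x|^β dx)` around continuous fields** (`1 ≤ p < ∞`,
`β > -3`): a continuous `U ∈ L^p(|x|^β dx)` is the `L^p(|x|^β dx)`-limit of a sequence of smooth
compactly supported fields (`|x|^β dx` is a Radon measure, so `C_c` is dense — Mathlib's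
`MemLp.exists_hasCompactSupport_eLpNorm_sub_le` — and `C_c` functions are mollified). This is
the approximation behind Tsai's "We then extend this result to general `U` … by approximation"
(p. 34) in the weighted setting of p. 45. [cite: Tsai1998, Lemma 2.1 proof (p. 34) and §4 p. 45] -/
theorem exists_smooth_seq_tendsto_eLpNorm_withDensity {β : ℝ} (hβ : -3 < β) {p : ℝ≥0∞}
    (hp1 : 1 ≤ p) (hp : p ≠ ⊤) {U : ℝ³ → G}
    (hU : MemLp U p (volume.withDensity fun x : ℝ³ => ‖x‖ₑ ^ β)) :
    ∃ w : ℕ → ℝ³ → G, (∀ n, ContDiff ℝ ∞ (w n) ∧ HasCompactSupport (w n)) ∧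
      Tendsto (fun n => eLpNorm (w n - U) p (volume.withDensity fun x : ℝ³ => ‖x‖ₑ ^ β))
        atTop (𝓝 0) := by
  set μ : Measure ℝ³ := volume.withDensity fun x : ℝ³ => ‖x‖ₑ ^ β with hμ
  haveI : IsLocallyFiniteMeasure μ := isLocallyFiniteMeasure_withDensity_enorm_rpow hβ
  have hp0 : p ≠ 0 := (zero_lt_one.trans_le hp1).ne'
  -- one test field within `ε`
  have step : ∀ ε : ℝ≥0∞, ε ≠ 0 → ∃ w : ℝ³ → G, ContDiff ℝ ∞ w ∧ HasCompactSupport w ∧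
      eLpNorm (w - U) p μ ≤ ε := by
    intro ε hε
    have hε2 : ε / 2 ≠ 0 := (ENNReal.half_pos hε).ne'
    obtain ⟨g, hgc, hg_le, hg_cont, -⟩ := hU.exists_hasCompactSupport_eLpNorm_sub_le hp hε2
    obtain ⟨w, hw, hwc, hw_le⟩ :=
      exists_smooth_eLpNorm_sub_le_of_hasCompactSupport (μ := μ) hp0 hp hg_cont hgc hε2
    refine ⟨w, hw, hwc, ?_⟩
    have e : w - U = (w - g) + (g - U) := by abel
    calc eLpNorm (w - U) p μ = eLpNorm ((w - g) + (g - U)) p μ := by rw [e]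
      _ ≤ eLpNorm (w - g) p μ + eLpNorm (g - U) p μ :=
          eLpNorm_add_le (hw.continuous.aestronglyMeasurable.sub hg_cont.aestronglyMeasurable)
            (hg_cont.aestronglyMeasurable.sub hU.1) hp1
      _ ≤ ε / 2 + ε / 2 := add_le_add hw_le (by rwa [eLpNorm_sub_comm])
      _ = ε := ENNReal.add_halves ε
  choose w hw hwc hwle using fun n : ℕ => step (ENNReal.ofReal (1 / ((n : ℝ) + 1))) (by positivity)
  refine ⟨w, fun n => ⟨hw n, hwc n⟩, ?_⟩
  have h0 : Tendsto (fun n : ℕ => ENNReal.ofReal (1 / ((n : ℝ) + 1))) atTop (𝓝 0) := by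
    simpa using ENNReal.tendsto_ofReal tendsto_one_div_add_atTop_nhds_zero_nat
  exact tendsto_of_tendsto_of_tendsto_of_le_of_le tendsto_const_nhds h0 (fun n => zero_le) hwle

end Approximation

/-! ## §6. Completeness: the limit `P̃ = lim p̃[wₙ]` in `L^{5/3}(|y|^{-5/3} dy)` -/

section Limit

/-- **Extraction of the limit** of an `L^p(μ)`-Cauchy sequence of functions (`1 ≤ p`), via the
completeness of Mathlib's `Lp` space: there is `Q ∈ L^p(μ)` with `‖Pₙ − Q‖_{L^p(μ)} → 0`.
[folklore] -/
theorem exists_memLp_tendsto_eLpNorm_sub_of_cauchy {μ : Measure ℝ³} {p : ℝ≥0∞} (hp1 : 1 ≤ p)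
    {P : ℕ → ℝ³ → ℝ} (hP : ∀ n, MemLp (P n) p μ)
    (hC : ∀ ε : ℝ≥0∞, ε ≠ 0 → ∃ N, ∀ n, N ≤ n → ∀ m, N ≤ m → eLpNorm (P n - P m) p μ ≤ ε) :
    ∃ Q : ℝ³ → ℝ, MemLp Q p μ ∧ Tendsto (fun n => eLpNorm (P n - Q) p μ) atTop (𝓝 0) := by
  haveI : Fact (1 ≤ p) := ⟨hp1⟩
  set s : ℕ → Lp ℝ p μ := fun n => (hP n).toLp (P n) with hs_def
  have hcauchy : CauchySeq s := by
    refine Metric.cauchySeq_iff.2 fun ε hε => ?_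
    obtain ⟨N, hN⟩ := hC (ENNReal.ofReal (ε / 2)) (ENNReal.ofReal_pos.2 (half_pos hε)).ne'
    refine ⟨N, fun m hm n hn => ?_⟩
    rw [Lp.dist_def]
    have e : eLpNorm (⇑(s m) - ⇑(s n)) p μ = eLpNorm (P m - P n) p μ :=
      eLpNorm_congr_ae ((hP m).coeFn_toLp.sub (hP n).coeFn_toLp)
    rw [e]
    calc (eLpNorm (P m - P n) p μ).toReal ≤ (ENNReal.ofReal (ε / 2)).toReal :=
          ENNReal.toReal_mono ENNReal.ofReal_ne_top (hN m hm n hn)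
      _ = ε / 2 := ENNReal.toReal_ofReal (by positivity)
      _ < ε := half_lt_self hε
  obtain ⟨Qlp, hQlp⟩ := cauchySeq_tendsto_of_complete hcauchy
  refine ⟨Qlp, Lp.memLp Qlp, ?_⟩
  have h := (Lp.tendsto_Lp_iff_tendsto_eLpNorm' s Qlp).1 hQlp
  refine h.congr fun n => eLpNorm_congr_ae ?_
  exact (hP n).coeFn_toLp.sub EventuallyEq.rfl

/-- **The Cauchy criterion from the bilinear estimate** (pure `ℝ≥0∞` bookkeeping): if
`D n m ≤ A (t² (Tₙ + Tₘ)² + t⁻² B)` for every `t > 0`, with `A, B < ∞` and `Tₙ → 0`, then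
`D n m → 0` as `n, m → ∞` (first choose `t` large, then `n, m` large). [folklore] -/
theorem cauchy_of_quadratic_bound {D : ℕ → ℕ → ℝ≥0∞} {T : ℕ → ℝ≥0∞} {A B : ℝ≥0∞}
    (hA : A ≠ ⊤) (hB : B ≠ ⊤) (hT : Tendsto T atTop (𝓝 0))
    (hD : ∀ t : ℝ, 0 < t → ∀ n m, D n m ≤
      A * (ENNReal.ofReal (t ^ 2) * (T n + T m) ^ 2 + ENNReal.ofReal (t⁻¹ ^ 2) * B)) :
    ∀ ε : ℝ≥0∞, ε ≠ 0 → ∃ N, ∀ n, N ≤ n → ∀ m, N ≤ m → D n m ≤ ε := by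
  intro ε hε
  have hε2 : ε / 2 ≠ 0 := (ENNReal.half_pos hε).ne'
  -- step 1: `t` with `A t⁻² B ≤ ε/2`
  have hAB1 : A * B + 1 ≠ ⊤ := ENNReal.add_ne_top.2 ⟨ENNReal.mul_ne_top hA hB, ENNReal.one_ne_top⟩
  set κ : ℝ≥0∞ := (ε / 2) / (A * B + 1) with hκ_def
  have hκ0 : κ ≠ 0 := (ENNReal.div_pos hε2 hAB1).ne'
  obtain ⟨σ, hσ0, hσκ⟩ : ∃ σ : ℝ, 0 < σ ∧ ENNReal.ofReal σ ≤ κ := by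
    rcases eq_or_ne κ ⊤ with h | h
    · exact ⟨1, one_pos, h ▸ le_top⟩
    · exact ⟨κ.toReal, ENNReal.toReal_pos hκ0 h, (ENNReal.ofReal_toReal h).le⟩
  have hσ : A * (ENNReal.ofReal σ * B) ≤ ε / 2 :=
    calc A * (ENNReal.ofReal σ * B) = A * B * ENNReal.ofReal σ := by ring
      _ ≤ (A * B + 1) * κ := mul_le_mul' le_self_add hσκ
      _ = ε / 2 := ENNReal.mul_div_cancel (by simp) hAB1
  set t : ℝ := (Real.sqrt σ)⁻¹ with ht_def
  have hsq : 0 < Real.sqrt σ := Real.sqrt_pos.2 hσ0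
  have ht0 : 0 < t := inv_pos.2 hsq
  have htσ : t⁻¹ ^ 2 = σ := by rw [ht_def, inv_inv, Real.sq_sqrt hσ0.le]
  -- step 2: `λ` with `4 A t² λ ≤ ε/2`, then `N` with `Tₙ < λ` beyond `N`
  have hA4 : 4 * A * ENNReal.ofReal (t ^ 2) + 1 ≠ ⊤ := by
    refine ENNReal.add_ne_top.2 ⟨ENNReal.mul_ne_top (ENNReal.mul_ne_top (by norm_num) hA)
      ENNReal.ofReal_ne_top, ENNReal.one_ne_top⟩
  set κ' : ℝ≥0∞ := (ε / 2) / (4 * A * ENNReal.ofReal (t ^ 2) + 1) with hκ'_def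
  set lam : ℝ≥0∞ := min 1 κ' with hlam_def
  have hlam0 : 0 < lam := lt_min zero_lt_one (ENNReal.div_pos hε2 hA4)
  have hlam1 : lam ≤ 1 := min_le_left _ _
  have hlamκ : lam ≤ κ' := min_le_right _ _
  obtain ⟨N, hN⟩ := eventually_atTop.1 (hT.eventually (gt_mem_nhds hlam0))
  refine ⟨N, fun n hn m hm => ?_⟩
  have hsum : (T n + T m) ^ 2 ≤ 4 * lam := by
    have h1 : T n + T m ≤ 2 * lam := by
      rw [two_mul]; exact add_le_add (hN n hn).le (hN m hm).le
    calc (T n + T m) ^ 2 ≤ (2 * lam) ^ 2 := pow_le_pow_left₀ zero_le h1 2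
      _ = 4 * (lam * lam) := by ring
      _ ≤ 4 * (lam * 1) := by gcongr
      _ = 4 * lam := by rw [mul_one]
  have hfirst : A * (ENNReal.ofReal (t ^ 2) * (T n + T m) ^ 2) ≤ ε / 2 :=
    calc A * (ENNReal.ofReal (t ^ 2) * (T n + T m) ^ 2)
        ≤ A * (ENNReal.ofReal (t ^ 2) * (4 * lam)) := by gcongr
      _ = 4 * A * ENNReal.ofReal (t ^ 2) * lam := by ring
      _ ≤ (4 * A * ENNReal.ofReal (t ^ 2) + 1) * κ' := mul_le_mul' le_self_add hlamκ
      _ = ε / 2 := ENNReal.mul_div_cancel (by simp) hA4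
  calc D n m ≤ A * (ENNReal.ofReal (t ^ 2) * (T n + T m) ^ 2 + ENNReal.ofReal (t⁻¹ ^ 2) * B) :=
        hD t ht0 n m
    _ = A * (ENNReal.ofReal (t ^ 2) * (T n + T m) ^ 2) + A * (ENNReal.ofReal σ * B) := by
        rw [htσ, mul_add]
    _ ≤ ε / 2 + ε / 2 := add_le_add hfirst hσ
    _ = ε := ENNReal.add_halves ε

end Limit

/-! ## §7. Passing to the limit in the two pairings -/

section Pairings

/-- **Linear pairing.** If `∫ |Fₙ − Q|^{5/3} |x|^{-5/3} → 0` then `∫ Fₙ ψ → ∫ Q ψ` for every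
continuous compactly supported `ψ` (weighted Hölder on a ball containing `supp ψ`). [cite: Tsai1998, §4 p. 45] -/
theorem tendsto_integral_mul_of_tendsto_weighted {F : ℕ → ℝ³ → ℝ} {Q : ℝ³ → ℝ}
    (hFm : ∀ n, AEStronglyMeasurable (F n) volume) (hQm : AEStronglyMeasurable Q volume)
    (hfin : ∀ n, ∫⁻ x, ‖F n x - Q x‖ₑ ^ (5 / 3 : ℝ) * ‖x‖ₑ ^ (-(5 / 3) : ℝ) ≠ ⊤)
    (hE : Tendsto (fun n => ∫⁻ x, ‖F n x - Q x‖ₑ ^ (5 / 3 : ℝ) * ‖x‖ₑ ^ (-(5 / 3) : ℝ)) atTop (𝓝 0))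
    {ψ : ℝ³ → ℝ} (hψ : Continuous ψ) (hψc : HasCompactSupport ψ)
    (hFi : ∀ n, Integrable fun x => F n x * ψ x) (hQi : Integrable fun x => Q x * ψ x) :
    Tendsto (fun n => ∫ x, F n x * ψ x) atTop (𝓝 (∫ x, Q x * ψ x)) := by
  have hpq : (5 / 3 : ℝ).HolderConjugate (5 / 2) := ⟨by norm_num, by norm_num, by norm_num⟩
  have hα : (0 : ℝ) < 5 / 3 := by norm_num
  -- a ball containing the support of `ψ` and a bound for `ψ`
  obtain ⟨R, hR0, hR⟩ : ∃ R : ℝ, 0 < R ∧ tsupport ψ ⊆ closedBall (0 : ℝ³) R := by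
    obtain ⟨R, hR⟩ := hψc.isCompact.isBounded.subset_closedBall (0 : ℝ³)
    exact ⟨max R 1, lt_max_of_lt_right one_pos, hR.trans (closedBall_subset_closedBall (le_max_left _ _))⟩
  obtain ⟨M, hM⟩ := hψ.bounded_above_of_compact_support hψc
  have hM0 : 0 ≤ M := (norm_nonneg _).trans (hM 0)
  -- the Hölder constant of the ball
  set cR : ℝ≥0∞ := (ENNReal.ofReal R ^ ((5 / 3 : ℝ) * (5 / 2) / (5 / 3)) *
    volume (closedBall (0 : ℝ³) R)) ^ (1 / (5 / 2 : ℝ)) with hcR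
  have hcRtop : cR ≠ ⊤ := by
    refine ENNReal.rpow_ne_top_of_nonneg (by norm_num) (ENNReal.mul_ne_top ?_ measure_closedBall_lt_top.ne)
    exact ENNReal.rpow_ne_top_of_nonneg (by norm_num) ENNReal.ofReal_ne_top
  set I : ℕ → ℝ≥0∞ := fun n => ∫⁻ x, ‖F n x - Q x‖ₑ ^ (5 / 3 : ℝ) * ‖x‖ₑ ^ (-(5 / 3) : ℝ) with hI
  -- the bound `|∫ Fₙψ − ∫ Qψ| ≤ M ((Iₙ)^{3/5} c_R).toReal`
  have hbound : ∀ n, ‖(∫ x, F n x * ψ x) - ∫ x, Q x * ψ x‖ ≤ M * ((I n) ^ (1 / (5 / 3 : ℝ)) * cR).toReal := by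
    intro n
    have hm : AEStronglyMeasurable (fun x => F n x - Q x) volume := (hFm n).sub hQm
    have hint := (setIntegral_norm_closedBall_le_weighted hm hpq hα (hfin n) hR0).1
    rw [← integral_sub (hFi n) hQi, Real.norm_eq_abs]
    have h1 : |∫ x, (F n x * ψ x - Q x * ψ x)| ≤ M * ∫ x in closedBall (0 : ℝ³) R, ‖F n x - Q x‖ := by
      have e : (fun x => F n x * ψ x - Q x * ψ x) = fun x => (F n x - Q x) * ψ x := by
        funext x; ring
      rw [e]
      refine abs_integral_le_of_bound_closedBall (F := fun x => F n x - Q x) (fun x => ?_) (fun x hx => ?_) hint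
      · rw [norm_mul, mul_comm]
        exact mul_le_mul_of_nonneg_right (hM x) (norm_nonneg _)
      · have : x ∉ tsupport ψ := fun h => not_lt.2 (mem_closedBall_zero_iff.1 (hR h)) hx
        rw [image_eq_zero_of_notMem_tsupport this, mul_zero]
    refine h1.trans (mul_le_mul_of_nonneg_left ?_ hM0)
    rw [integral_norm_eq_lintegral_enorm hm.restrict]
    have h2 := lintegral_enorm_closedBall_le_weighted hm hpq hα R
    exact ENNReal.toReal_mono (ENNReal.mul_ne_top (ENNReal.rpow_ne_top_of_nonneg (by norm_num) (hfin n)) hcRtop) h2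
  -- the bound tends to zero
  have hlim : Tendsto (fun n => M * ((I n) ^ (1 / (5 / 3 : ℝ)) * cR).toReal) atTop (𝓝 0) := by
    have h1 : Tendsto (fun n => (I n) ^ (1 / (5 / 3 : ℝ))) atTop (𝓝 0) := by
      have h := ((ENNReal.continuous_rpow_const (y := 1 / (5 / 3 : ℝ))).tendsto 0).comp hE
      rwa [ENNReal.zero_rpow_of_pos (by norm_num)] at h
    have h2 : Tendsto (fun n => (I n) ^ (1 / (5 / 3 : ℝ)) * cR) atTop (𝓝 0) := by
      have h := ENNReal.Tendsto.mul_const h1 (Or.inr hcRtop)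
      rwa [zero_mul] at h
    have h3 : Tendsto (fun n => ((I n) ^ (1 / (5 / 3 : ℝ)) * cR).toReal) atTop (𝓝 0) := by
      have h := (ENNReal.tendsto_toReal ENNReal.zero_ne_top).comp h2
      rwa [ENNReal.toReal_zero] at h
    simpa using h3.const_mul M
  exact tendsto_sub_nhds_zero_iff.1 (squeeze_zero_norm hbound hlim)

/-- The weighted `L^{10/3}` norm controls `∫_{B_R} |f|²`:
`∫_{|x|≤R} |f|² ≤ ‖f‖²_{L^{10/3}(|x|^{-5/3})} c_R`. [cite: Tsai1998, §4 p. 45] -/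
theorem lintegral_closedBall_enorm_sq_le {f : ℝ³ → ℝ³} (hf : AEStronglyMeasurable f volume) (R : ℝ) :
    ∫⁻ x in closedBall (0 : ℝ³) R, ‖f x‖ₑ ^ 2 ≤
      eLpNorm f (ENNReal.ofReal (10 / 3)) (volume.withDensity fun x : ℝ³ => ‖x‖ₑ ^ (-(5 / 3) : ℝ)) ^ 2 *
        (ENNReal.ofReal R ^ ((5 / 3 : ℝ) * (5 / 2) / (5 / 3)) * volume (closedBall (0 : ℝ³) R)) ^
          (1 / (5 / 2 : ℝ)) := by
  have hpq : (5 / 3 : ℝ).HolderConjugate (5 / 2) := ⟨by norm_num, by norm_num, by norm_num⟩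
  have hα : (0 : ℝ) < 5 / 3 := by norm_num
  have hFm : AEStronglyMeasurable (fun x => ‖f x‖ ^ 2) volume := (hf.norm.pow 2)
  have h := lintegral_enorm_closedBall_le_weighted hFm hpq hα R
  have e1 : ∀ x, ‖(‖f x‖ ^ 2)‖ₑ = ‖f x‖ₑ ^ 2 := fun x => by
    rw [Real.enorm_eq_ofReal (sq_nonneg _), ENNReal.ofReal_pow (norm_nonneg _), ofReal_norm]
  have e2 : ∀ x, (‖f x‖ₑ ^ 2) ^ (5 / 3 : ℝ) = ‖f x‖ₑ ^ (10 / 3 : ℝ) := fun x => by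
    rw [← ENNReal.rpow_natCast, ← ENNReal.rpow_mul]
    norm_num
  simp_rw [e1] at h
  simp_rw [e2] at h
  refine h.trans_eq ?_
  congr 1
  have hp0 : ENNReal.ofReal (10 / 3) ≠ 0 := (ENNReal.ofReal_pos.2 (by norm_num)).ne'
  rw [eLpNorm_withDensity_enorm_rpow f (-(5 / 3)) hp0 ENNReal.ofReal_ne_top,
    ENNReal.toReal_ofReal (by norm_num), ← ENNReal.rpow_natCast, ← ENNReal.rpow_mul]
  norm_num

/-- The symmetric-difference bound for a bilinear form on the diagonal:
`|L(a,a) − L(b,b)| ≤ ‖L‖ |a − b| (|a| + |b|)`. [folklore] -/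
theorem norm_bilin_apply_self_sub_le (L : ℝ³ →L[ℝ] ℝ³ →L[ℝ] ℝ) (a b : ℝ³) :
    ‖L a a - L b b‖ ≤ ‖L‖ * (‖a - b‖ * (‖a‖ + ‖b‖)) := by
  have e : L a a - L b b = L (a - b) a + L b (a - b) := by
    simp only [map_sub, _root_.FunLike.coe_sub, Pi.sub_apply]
    ring
  rw [e]
  calc ‖L (a - b) a + L b (a - b)‖ ≤ ‖L (a - b) a‖ + ‖L b (a - b)‖ := norm_add_le _ _
    _ ≤ ‖L‖ * ‖a - b‖ * ‖a‖ + ‖L‖ * ‖b‖ * ‖a - b‖ :=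
        add_le_add ((L _).le_of_opNorm_le (L.le_opNorm _) _) ((L _).le_of_opNorm_le (L.le_opNorm _) _)
    _ = ‖L‖ * (‖a - b‖ * (‖a‖ + ‖b‖)) := by ring

/-- **Cauchy–Schwarz on a ball in weighted terms**: for continuous fields `f, g`,
`∫_{|x|≤R} |f − g| (|f| + |g|) ≤ (‖f − g‖ c_R^{1/2}) ((‖f‖ + ‖g‖) c_R^{1/2})`, norms in
`L^{10/3}(|x|^{-5/3} dx)`. [cite: Tsai1998, §4 p. 45] -/
theorem lintegral_closedBall_enorm_sub_mul_le {f g : ℝ³ → ℝ³} (hf : Continuous f) (hg : Continuous g)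
    (R : ℝ) :
    ∫⁻ x in closedBall (0 : ℝ³) R, ‖f x - g x‖ₑ * (‖f x‖ₑ + ‖g x‖ₑ) ≤
      (eLpNorm (f - g) (ENNReal.ofReal (10 / 3)) (volume.withDensity fun x : ℝ³ => ‖x‖ₑ ^ (-(5 / 3) : ℝ)) *
          ((ENNReal.ofReal R ^ ((5 / 3 : ℝ) * (5 / 2) / (5 / 3)) * volume (closedBall (0 : ℝ³) R)) ^
            (1 / (5 / 2 : ℝ))) ^ (1 / (2 : ℝ))) *
        ((eLpNorm f (ENNReal.ofReal (10 / 3)) (volume.withDensity fun x : ℝ³ => ‖x‖ₑ ^ (-(5 / 3) : ℝ)) +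
            eLpNorm g (ENNReal.ofReal (10 / 3)) (volume.withDensity fun x : ℝ³ => ‖x‖ₑ ^ (-(5 / 3) : ℝ))) *
          ((ENNReal.ofReal R ^ ((5 / 3 : ℝ) * (5 / 2) / (5 / 3)) * volume (closedBall (0 : ℝ³) R)) ^
            (1 / (5 / 2 : ℝ))) ^ (1 / (2 : ℝ))) := by
  set μ : Measure ℝ³ := volume.withDensity fun x : ℝ³ => ‖x‖ₑ ^ (-(5 / 3) : ℝ) with hμ
  set p₁₀ : ℝ≥0∞ := ENNReal.ofReal (10 / 3) with hp₁₀
  set cR : ℝ≥0∞ := (ENNReal.ofReal R ^ ((5 / 3 : ℝ) * (5 / 2) / (5 / 3)) *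
    volume (closedBall (0 : ℝ³) R)) ^ (1 / (5 / 2 : ℝ)) with hcR
  have hp1 : 1 ≤ p₁₀ := by
    rw [hp₁₀, ← ENNReal.ofReal_one]; exact ENNReal.ofReal_le_ofReal (by norm_num)
  have h22 : (2 : ℝ).HolderConjugate 2 := ⟨by norm_num, by norm_num, by norm_num⟩
  have hm1 : AEMeasurable (fun x => ‖f x - g x‖ₑ) (volume.restrict (closedBall (0 : ℝ³) R)) :=
    ((hf.sub hg).aestronglyMeasurable).enorm.restrict
  have hm2 : AEMeasurable (fun x => ‖f x‖ₑ + ‖g x‖ₑ) (volume.restrict (closedBall (0 : ℝ³) R)) :=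
    (hf.aestronglyMeasurable.enorm.add hg.aestronglyMeasurable.enorm).restrict
  have hCS := ENNReal.lintegral_mul_le_Lp_mul_Lq (volume.restrict (closedBall (0 : ℝ³) R)) h22 hm1 hm2
  refine hCS.trans (mul_le_mul' ?_ ?_)
  · -- `(∫_B |f − g|²)^{1/2} ≤ ‖f − g‖ c_R^{1/2}`
    have hfg : AEStronglyMeasurable (fun x => f x - g x) volume := (hf.sub hg).aestronglyMeasurable
    have h := lintegral_closedBall_enorm_sq_le (f := fun x => f x - g x) hfg R
    calc (∫⁻ x in closedBall (0 : ℝ³) R, ‖f x - g x‖ₑ ^ (2 : ℝ)) ^ (1 / (2 : ℝ))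
        ≤ (eLpNorm (fun x => f x - g x) p₁₀ μ ^ 2 * cR) ^ (1 / (2 : ℝ)) := by
          gcongr
          refine le_of_eq_of_le (lintegral_congr fun x => ?_) h
          rw [ENNReal.rpow_two]
      _ = eLpNorm (f - g) p₁₀ μ * cR ^ (1 / (2 : ℝ)) := by
          rw [ENNReal.mul_rpow_of_nonneg _ _ (by norm_num), ← ENNReal.rpow_natCast,
            ← ENNReal.rpow_mul]
          norm_num
          rfl
  · -- `(∫_B (|f| + |g|)²)^{1/2} ≤ (‖f‖ + ‖g‖) c_R^{1/2}`
    set G : ℝ³ → ℝ := fun x => ‖f x‖ + ‖g x‖ with hG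
    have hGm : AEStronglyMeasurable G volume := (hf.norm.add hg.norm).aestronglyMeasurable
    have h := lintegral_enorm_closedBall_le_weighted (F := fun x => ‖G x‖ ^ 2)
      (hGm.norm.pow 2) (⟨by norm_num, by norm_num, by norm_num⟩ : (5 / 3 : ℝ).HolderConjugate (5 / 2))
      (by norm_num : (0 : ℝ) < 5 / 3) R
    have e1 : ∀ x, ‖(‖G x‖ ^ 2)‖ₑ = ‖G x‖ₑ ^ (2 : ℝ) := fun x => by
      rw [Real.enorm_eq_ofReal (sq_nonneg _), ENNReal.ofReal_pow (norm_nonneg _), ofReal_norm,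
        ENNReal.rpow_two]
    have e1' : ∀ x, ‖G x‖ₑ = ‖f x‖ₑ + ‖g x‖ₑ := fun x => by
      rw [hG]
      simp only
      rw [Real.enorm_eq_ofReal (by positivity), ENNReal.ofReal_add (norm_nonneg _) (norm_nonneg _),
        ofReal_norm, ofReal_norm]
    have e2 : ∀ x, (‖G x‖ₑ ^ (2 : ℝ)) ^ (5 / 3 : ℝ) = ‖G x‖ₑ ^ (10 / 3 : ℝ) := fun x => by
      rw [← ENNReal.rpow_mul]
      norm_num
    simp_rw [e1] at h
    simp_rw [e2] at h
    have hnorm : (∫⁻ x, ‖G x‖ₑ ^ (10 / 3 : ℝ) * ‖x‖ₑ ^ (-(5 / 3) : ℝ)) ^ (1 / (5 / 3 : ℝ)) =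
        eLpNorm G p₁₀ μ ^ 2 := by
      have hp0 : p₁₀ ≠ 0 := (ENNReal.ofReal_pos.2 (by norm_num)).ne'
      rw [eLpNorm_withDensity_enorm_rpow G (-(5 / 3)) hp0 ENNReal.ofReal_ne_top, hp₁₀,
        ENNReal.toReal_ofReal (by norm_num), ← ENNReal.rpow_natCast, ← ENNReal.rpow_mul]
      norm_num
    have htri : eLpNorm G p₁₀ μ ≤ eLpNorm f p₁₀ μ + eLpNorm g p₁₀ μ := by
      have e : G = (fun x => ‖f x‖) + fun x => ‖g x‖ := rfl
      rw [e]
      refine (eLpNorm_add_le hf.norm.aestronglyMeasurable hg.norm.aestronglyMeasurable hp1).trans ?_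
      rw [eLpNorm_norm, eLpNorm_norm]
    calc (∫⁻ x in closedBall (0 : ℝ³) R, (‖f x‖ₑ + ‖g x‖ₑ) ^ (2 : ℝ)) ^ (1 / (2 : ℝ))
        ≤ (eLpNorm G p₁₀ μ ^ 2 * cR) ^ (1 / (2 : ℝ)) := by
          gcongr
          rw [← hnorm]
          refine le_of_eq_of_le (lintegral_congr fun x => ?_) h
          rw [e1']
      _ = eLpNorm G p₁₀ μ * cR ^ (1 / (2 : ℝ)) := by
          rw [ENNReal.mul_rpow_of_nonneg _ _ (by norm_num), ← ENNReal.rpow_natCast,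
            ← ENNReal.rpow_mul]
          norm_num
      _ ≤ (eLpNorm f p₁₀ μ + eLpNorm g p₁₀ μ) * cR ^ (1 / (2 : ℝ)) := by gcongr

/-- Norms converge when differences go to zero: `‖wₙ − U‖ → 0` implies `‖wₙ‖ → ‖U‖` (in any
`L^p`, `1 ≤ p`). [folklore] -/
theorem tendsto_eLpNorm_of_tendsto_eLpNorm_sub {μ : Measure ℝ³} {p : ℝ≥0∞} (hp1 : 1 ≤ p)
    {G : Type*} [NormedAddCommGroup G] {w : ℕ → ℝ³ → G} {U : ℝ³ → G}
    (hw : ∀ n, AEStronglyMeasurable (w n) μ) (hU : AEStronglyMeasurable U μ)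
    (hT : Tendsto (fun n => eLpNorm (w n - U) p μ) atTop (𝓝 0)) :
    Tendsto (fun n => eLpNorm (w n) p μ) atTop (𝓝 (eLpNorm U p μ)) := by
  have hup : ∀ n, eLpNorm (w n) p μ ≤ eLpNorm (w n - U) p μ + eLpNorm U p μ := fun n => by
    have e : w n = (w n - U) + U := by abel
    conv_lhs => rw [e]
    exact eLpNorm_add_le ((hw n).sub hU) hU hp1
  have hdown : ∀ n, eLpNorm U p μ ≤ eLpNorm (w n - U) p μ + eLpNorm (w n) p μ := fun n => by
    have e : U = (U - w n) + w n := by abel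
    conv_lhs => rw [e]
    refine (eLpNorm_add_le (hU.sub (hw n)) (hw n) hp1).trans ?_
    rw [eLpNorm_sub_comm]
  have hlim_up : Tendsto (fun n => eLpNorm (w n - U) p μ + eLpNorm U p μ) atTop (𝓝 (eLpNorm U p μ)) := by
    have h := hT.add (tendsto_const_nhds (x := eLpNorm U p μ))
    rwa [zero_add] at h
  have hlim_down : Tendsto (fun n => eLpNorm U p μ - eLpNorm (w n - U) p μ) atTop (𝓝 (eLpNorm U p μ)) := by
    have h := ENNReal.Tendsto.sub (tendsto_const_nhds (x := eLpNorm U p μ)) hT (Or.inr ENNReal.zero_ne_top)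
    rwa [tsub_zero] at h
  refine tendsto_of_tendsto_of_tendsto_of_le_of_le hlim_down hlim_up (fun n => ?_) hup
  exact tsub_le_iff_right.2 (by rw [add_comm]; exact hdown n)

-- nested operator types `ℝ³ →L[ℝ] ℝ³ →L[ℝ] ℝ` (curried second derivatives)
set_option maxSynthPendingDepth 3 in
/-- **Quadratic pairing.** If `wₙ → U` in `L^{10/3}(|x|^{-5/3} dx)` (continuous fields, `U` in
the space) then `∫ D²φ(wₙ, wₙ) → ∫ D²φ(U, U)` for every test function `φ`:
`|D²φ(a,a) − D²φ(b,b)| ≤ ‖D²φ‖ |a − b| (|a| + |b|)`, Cauchy–Schwarz on the ball carrying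
`supp φ`, and the weighted control of `∫_{B_R} |f|²`. [cite: Tsai1998, §4 p. 45] -/
theorem tendsto_integral_hessian_apply {w : ℕ → ℝ³ → ℝ³} {U : ℝ³ → ℝ³}
    (hw : ∀ n, Continuous (w n)) (hU : Continuous U)
    (hT : Tendsto (fun n => eLpNorm (w n - U) (ENNReal.ofReal (10 / 3))
      (volume.withDensity fun x : ℝ³ => ‖x‖ₑ ^ (-(5 / 3) : ℝ))) atTop (𝓝 0))
    (hUtop : eLpNorm U (ENNReal.ofReal (10 / 3))
      (volume.withDensity fun x : ℝ³ => ‖x‖ₑ ^ (-(5 / 3) : ℝ)) ≠ ⊤)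
    {φ : ℝ³ → ℝ} (hφ : ContDiff ℝ (⊤ : ℕ∞) φ) (hφc : HasCompactSupport φ) :
    Tendsto (fun n => ∫ x, fderiv ℝ (fderiv ℝ φ) x (w n x) (w n x)) atTop
      (𝓝 (∫ x, fderiv ℝ (fderiv ℝ φ) x (U x) (U x))) := by
  -- the Hessian: continuity, support, bound
  have hφ2 : ContDiff ℝ 2 φ := contDiff_infty.1 hφ 2
  have hD2c : Continuous (fderiv ℝ (fderiv ℝ φ)) :=
    (hφ2.fderiv_right (m := 1) (by norm_num)).continuous_fderiv one_ne_zero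
  have hD2s : HasCompactSupport (fderiv ℝ (fderiv ℝ φ)) := (hφc.fderiv (𝕜 := ℝ)).fderiv (𝕜 := ℝ)
  obtain ⟨M, hM⟩ := hD2c.bounded_above_of_compact_support hD2s
  obtain ⟨R, hR0, hR⟩ : ∃ R : ℝ, 0 < R ∧ tsupport (fderiv ℝ (fderiv ℝ φ)) ⊆ closedBall (0 : ℝ³) R := by
    obtain ⟨R, hR⟩ := hD2s.isCompact.isBounded.subset_closedBall (0 : ℝ³)
    exact ⟨max R 1, lt_max_of_lt_right one_pos, hR.trans (closedBall_subset_closedBall (le_max_left _ _))⟩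
  set μ : Measure ℝ³ := volume.withDensity fun x : ℝ³ => ‖x‖ₑ ^ (-(5 / 3) : ℝ) with hμ
  set p₁₀ : ℝ≥0∞ := ENNReal.ofReal (10 / 3) with hp₁₀
  have hp1 : 1 ≤ p₁₀ := by
    rw [hp₁₀, ← ENNReal.ofReal_one]; exact ENNReal.ofReal_le_ofReal (by norm_num)
  set cR : ℝ≥0∞ := ((ENNReal.ofReal R ^ ((5 / 3 : ℝ) * (5 / 2) / (5 / 3)) *
    volume (closedBall (0 : ℝ³) R)) ^ (1 / (5 / 2 : ℝ))) ^ (1 / (2 : ℝ)) with hcR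
  have hcRtop : cR ≠ ⊤ := by
    refine ENNReal.rpow_ne_top_of_nonneg (by norm_num) (ENNReal.rpow_ne_top_of_nonneg (by norm_num)
      (ENNReal.mul_ne_top ?_ measure_closedBall_lt_top.ne))
    exact ENNReal.rpow_ne_top_of_nonneg (by norm_num) ENNReal.ofReal_ne_top
  -- the integrands and their integrability
  have hHi : ∀ {v : ℝ³ → ℝ³}, Continuous v →
      Integrable fun x => fderiv ℝ (fderiv ℝ φ) x (v x) (v x) := by
    intro v hv
    refine ((hD2c.clm_apply hv).clm_apply hv).integrable_of_hasCompactSupport ?_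
    exact hD2s.mono fun x hx => by
      contrapose! hx
      simp only [mem_support, not_not] at hx ⊢
      simp [hx]
  -- the real-valued product `aₙ = |wₙ − U| (|wₙ| + |U|)` and its ball integral
  set a : ℕ → ℝ³ → ℝ := fun n x => ‖w n x - U x‖ * (‖w n x‖ + ‖U x‖) with ha
  have hac : ∀ n, Continuous (a n) := fun n => ((hw n).sub hU).norm.mul ((hw n).norm.add hU.norm)
  have ha0 : ∀ n x, 0 ≤ a n x := fun n x => by positivity
  set J : ℕ → ℝ≥0∞ := fun n => ∫⁻ x in closedBall (0 : ℝ³) R, ‖a n x‖ₑ with hJ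
  have hJ_eq : ∀ n, J n = ∫⁻ x in closedBall (0 : ℝ³) R, ‖w n x - U x‖ₑ * (‖w n x‖ₑ + ‖U x‖ₑ) := by
    intro n
    refine lintegral_congr fun x => ?_
    rw [Real.enorm_eq_ofReal (ha0 n x), ha]
    simp only
    rw [ENNReal.ofReal_mul (norm_nonneg _), ENNReal.ofReal_add (norm_nonneg _) (norm_nonneg _),
      ofReal_norm, ofReal_norm, ofReal_norm]
  -- `|∫ H(wₙ) − ∫ H(U)| ≤ M (J n).toReal`
  have hbound : ∀ n, ‖(∫ x, fderiv ℝ (fderiv ℝ φ) x (w n x) (w n x)) -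
      ∫ x, fderiv ℝ (fderiv ℝ φ) x (U x) (U x)‖ ≤ M * (J n).toReal := by
    intro n
    rw [← integral_sub (hHi (hw n)) (hHi hU), Real.norm_eq_abs]
    have hai : IntegrableOn (a n) (closedBall (0 : ℝ³) R) :=
      (hac n).continuousOn.integrableOn_compact (isCompact_closedBall _ _)
    have h1 := abs_integral_le_of_bound_closedBall
      (H := fun x => fderiv ℝ (fderiv ℝ φ) x (w n x) (w n x) - fderiv ℝ (fderiv ℝ φ) x (U x) (U x))
      (F := a n) (M := M) (fun x => ?_) (fun x hx => ?_) hai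
    · refine h1.trans_eq ?_
      rw [integral_norm_eq_lintegral_enorm (hac n).aestronglyMeasurable.restrict]
    · rw [Real.norm_of_nonneg (ha0 n x)]
      exact (norm_bilin_apply_self_sub_le _ _ _).trans (mul_le_mul_of_nonneg_right (hM x) (ha0 n x))
    · have hx' : x ∉ tsupport (fderiv ℝ (fderiv ℝ φ)) := fun h =>
        not_lt.2 (mem_closedBall_zero_iff.1 (hR h)) hx
      simp [image_eq_zero_of_notMem_tsupport hx']
  -- `J n → 0`
  have hJ0 : Tendsto J atTop (𝓝 0) := by
    have hJle : ∀ n, J n ≤ (eLpNorm (w n - U) p₁₀ μ * cR) *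
        ((eLpNorm (w n) p₁₀ μ + eLpNorm U p₁₀ μ) * cR) := fun n => by
      rw [hJ_eq n]
      exact lintegral_closedBall_enorm_sub_mul_le (hw n) hU R
    have hwn : Tendsto (fun n => eLpNorm (w n) p₁₀ μ) atTop (𝓝 (eLpNorm U p₁₀ μ)) :=
      tendsto_eLpNorm_of_tendsto_eLpNorm_sub hp1 (fun n => (hw n).aestronglyMeasurable)
        hU.aestronglyMeasurable hT
    have h1 : Tendsto (fun n => eLpNorm (w n - U) p₁₀ μ * cR) atTop (𝓝 0) := by
      have h := ENNReal.Tendsto.mul_const hT (Or.inr hcRtop)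
      rwa [zero_mul] at h
    have h2 : Tendsto (fun n => (eLpNorm (w n) p₁₀ μ + eLpNorm U p₁₀ μ) * cR) atTop
        (𝓝 ((eLpNorm U p₁₀ μ + eLpNorm U p₁₀ μ) * cR)) :=
      ENNReal.Tendsto.mul_const (hwn.add tendsto_const_nhds) (Or.inr hcRtop)
    have hfin : (eLpNorm U p₁₀ μ + eLpNorm U p₁₀ μ) * cR ≠ ⊤ :=
      ENNReal.mul_ne_top (ENNReal.add_ne_top.2 ⟨hUtop, hUtop⟩) hcRtop
    have h3 := ENNReal.Tendsto.mul h1 (Or.inr hfin) h2 (Or.inr ENNReal.zero_ne_top)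
    rw [zero_mul] at h3
    exact tendsto_of_tendsto_of_tendsto_of_le_of_le tendsto_const_nhds h3 (fun n => zero_le) hJle
  -- conclusion
  have hlim : Tendsto (fun n => M * (J n).toReal) atTop (𝓝 0) := by
    have h := (ENNReal.tendsto_toReal ENNReal.zero_ne_top).comp hJ0
    rw [ENNReal.toReal_zero] at h
    simpa using h.const_mul M
  exact tendsto_sub_nhds_zero_iff.1 (squeeze_zero_norm hbound hlim)

end Pairings

/-! ## §8. Assembly: `tsai1998_weightedRieszPressure` from the power-weighted bound -/

section Assembly

/-- `‖ |f|² ‖_{L^{5/3}(μ)} = ‖f‖²_{L^{10/3}(μ)}`. [folklore] -/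
theorem eLpNorm_norm_sq_eq {μ : Measure ℝ³} (f : ℝ³ → ℝ³) :
    eLpNorm (fun x => ‖f x‖ ^ 2) (ENNReal.ofReal (5 / 3)) μ = eLpNorm f (ENNReal.ofReal (10 / 3)) μ ^ 2 := by
  have h := eLpNorm_norm_rpow f (p := ENNReal.ofReal (5 / 3)) (μ := μ) (q := 2) two_pos
  have e1 : (fun x => ‖f x‖ ^ (2 : ℝ)) = fun x => ‖f x‖ ^ 2 := by
    funext x; exact Real.rpow_two _
  have e2 : ENNReal.ofReal (5 / 3) * ENNReal.ofReal 2 = ENNReal.ofReal (10 / 3) := by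
    rw [← ENNReal.ofReal_mul (by norm_num)]; norm_num
  rw [e1, e2, ENNReal.rpow_two] at h
  exact h

/-- The power weight `|x|^{-5/3}` never vanishes (it is `⊤` at the origin). [folklore] -/
theorem enorm_rpow_neg_ne_zero (x : ℝ³) : ‖x‖ₑ ^ (-(5 / 3) : ℝ) ≠ 0 := by
  intro h
  rcases ENNReal.rpow_eq_zero_iff.1 h with ⟨_, h2⟩ | ⟨h1, _⟩
  · norm_num at h2
  · exact enorm_ne_top h1

/-- A function a.e.-strongly measurable for `|x|^{-5/3} dx` is so for Lebesgue measure (the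
density is everywhere nonzero). [folklore] -/
theorem aestronglyMeasurable_of_withDensity {G : Type*} [TopologicalSpace G] {Q : ℝ³ → G}
    (hQ : AEStronglyMeasurable Q (volume.withDensity fun x : ℝ³ => ‖x‖ₑ ^ (-(5 / 3) : ℝ))) :
    AEStronglyMeasurable Q volume := by
  refine ⟨hQ.mk Q, hQ.stronglyMeasurable_mk, ?_⟩
  have h := (ae_withDensity_iff (measurable_enorm_rpow (-(5 / 3)))).1 hQ.ae_eq_mk
  filter_upwards [h] with x hx
  exact hx (enorm_rpow_neg_ne_zero x)

/-- **Tsai's weighted Riesz-transform pressure from the `A_p` bound on test fields** (Tsai 1998,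
p. 45: "Therefore, given `U` satisfying (4.3), we can set `P̃ = Σ RᵢRⱼ(UᵢUⱼ)` and we have
`‖P̃‖_{w,5/3} ≤ C Σ ‖UᵢUⱼ‖_{w,5/3}` … `P̃` satisfies (2.1) in the distributional sense. This can be
proved in the same way as in Lemma 2.1" — i.e. "(2.5) can be established for `U ∈ C_c^∞` … We
then extend this result to general `U` … by approximation", p. 34). Given the power-weighted
bound `grafakos2014_normalisedPressure_powerWeight_bound` (Stein 1993 Ch. V / Grafakos 2014
Thm 7.4.6 with Ex. 7.1.7) at `p = 5/3`, `β = −5/3`: approximate the continuous `U` with (4.3)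
by test fields `wₙ` in `L^{10/3}(|y|^{-5/3} dy)` (§5); `p̃[wₙ]` is Cauchy in
`L^{5/3}(|y|^{-5/3} dy)` by the bilinear estimate (§3) and converges to some `P̃` (§6, completeness);
the norm bound passes to the limit and so does (2.5) (§4, §7). Hence `tsai1998_weightedRieszPressure`,
with constant `C^{5/3}`. [cite: Tsai1998, §4 p. 45 and Lemma 2.1 proof (p. 34)] -/
theorem tsai1998_weightedRieszPressure_of_powerWeight
    (h : grafakos2014_normalisedPressure_powerWeight_bound) : tsai1998_weightedRieszPressure := by
  -- exponents, the weighted measure, the constant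
  set p₅ : ℝ≥0∞ := ENNReal.ofReal (5 / 3) with hp₅
  set p₁₀ : ℝ≥0∞ := ENNReal.ofReal (10 / 3) with hp₁₀
  set μ : Measure ℝ³ := volume.withDensity fun x : ℝ³ => ‖x‖ₑ ^ (-(5 / 3) : ℝ) with hμ
  have hp₅1 : 1 < p₅ := by
    rw [hp₅, ← ENNReal.ofReal_one]; exact (ENNReal.ofReal_lt_ofReal_iff (by norm_num)).2 (by norm_num)
  have hp₅1' : 1 ≤ p₅ := hp₅1.le
  have hp₁₀1 : 1 ≤ p₁₀ := by
    rw [hp₁₀, ← ENNReal.ofReal_one]; exact ENNReal.ofReal_le_ofReal (by norm_num)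
  have hp₅0 : p₅ ≠ 0 := (zero_lt_one.trans hp₅1).ne'
  have hp₁₀0 : p₁₀ ≠ 0 := (zero_lt_one.trans_le hp₁₀1).ne'
  have hβ : (-3 : ℝ) < -(5 / 3) := by norm_num
  obtain ⟨C, hC⟩ := h p₅ hp₅1 ENNReal.ofReal_lt_top (-(5 / 3)) hβ
    (by rw [hp₅, ENNReal.toReal_ofReal (by norm_num)]; norm_num)
  haveI : IsLocallyFiniteMeasure μ := isLocallyFiniteMeasure_withDensity_enorm_rpow hβ
  -- conversions between `eLpNorm` for `μ` and the weighted Lebesgue integrals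
  have hconvU : ∀ (V : ℝ³ → ℝ³), eLpNorm V p₁₀ μ =
      (∫⁻ y, ‖V y‖ₑ ^ (10 / 3 : ℝ) * ‖y‖ₑ ^ (-(5 / 3) : ℝ)) ^ (1 / (10 / 3 : ℝ)) := fun V => by
    rw [eLpNorm_withDensity_enorm_rpow V (-(5 / 3)) hp₁₀0 ENNReal.ofReal_ne_top, hp₁₀,
      ENNReal.toReal_ofReal (by norm_num)]
  have hconvQ : ∀ (V : ℝ³ → ℝ), eLpNorm V p₅ μ =
      (∫⁻ y, ‖V y‖ₑ ^ (5 / 3 : ℝ) * ‖y‖ₑ ^ (-(5 / 3) : ℝ)) ^ (1 / (5 / 3 : ℝ)) := fun V => by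
    rw [eLpNorm_withDensity_enorm_rpow V (-(5 / 3)) hp₅0 ENNReal.ofReal_ne_top, hp₅,
      ENNReal.toReal_ofReal (by norm_num)]
  refine ⟨C ^ (5 / 3 : ℝ), fun U hUc hIU => ?_⟩
  -- `U ∈ L^{10/3}(μ)`
  have hUm : AEStronglyMeasurable U μ := hUc.aestronglyMeasurable
  have hUnorm : eLpNorm U p₁₀ μ ≠ ⊤ := by
    rw [hconvU]
    exact ENNReal.rpow_ne_top_of_nonneg (by norm_num) hIU.ne
  have hUmem : MemLp U p₁₀ μ := ⟨hUm, hUnorm.lt_top⟩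
  -- §5: test fields `wₙ → U`, normalised so that `‖wₙ − U‖ ≤ 1`
  obtain ⟨w₀, hw₀, hT₀⟩ := exists_smooth_seq_tendsto_eLpNorm_withDensity hβ hp₁₀1 ENNReal.ofReal_ne_top hUmem
  obtain ⟨N₀, hN₀⟩ := eventually_atTop.1 (hT₀.eventually (gt_mem_nhds zero_lt_one))
  set w : ℕ → ℝ³ → ℝ³ := fun n => w₀ (n + N₀) with hw_def
  have hw : ∀ n, ContDiff ℝ ∞ (w n) ∧ HasCompactSupport (w n) := fun n => hw₀ (n + N₀)
  have hT : Tendsto (fun n => eLpNorm (w n - U) p₁₀ μ) atTop (𝓝 0) :=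
    hT₀.comp (tendsto_add_atTop_nat N₀)
  have hT1 : ∀ n, eLpNorm (w n - U) p₁₀ μ ≤ 1 := fun n => (hN₀ (n + N₀) (Nat.le_add_left _ _)).le
  have hwc : ∀ n, Continuous (w n) := fun n => (hw n).1.continuous
  have hwn : ∀ n, eLpNorm (w n) p₁₀ μ ≤ 1 + eLpNorm U p₁₀ μ := fun n => by
    have e : w n = (w n - U) + U := by abel
    calc eLpNorm (w n) p₁₀ μ = eLpNorm ((w n - U) + U) p₁₀ μ := by rw [← e]
      _ ≤ eLpNorm (w n - U) p₁₀ μ + eLpNorm U p₁₀ μ :=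
          eLpNorm_add_le ((hwc n).aestronglyMeasurable.sub hUm) hUm hp₁₀1
      _ ≤ 1 + eLpNorm U p₁₀ μ := add_le_add (hT1 n) le_rfl
  -- the normalised pressures `Pₙ = p̃[wₙ]`
  set P : ℕ → ℝ³ → ℝ := fun n => normalisedPressure (w n) with hP_def
  have hPc : ∀ n, Continuous (P n) := fun n =>
    continuous_normalisedPressure_of_hasCompactSupport (hw n).1 (hw n).2
  have hPbound : ∀ n, eLpNorm (P n) p₅ μ ≤ C * eLpNorm (w n) p₁₀ μ ^ 2 := fun n => by
    rw [← eLpNorm_norm_sq_eq]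
    exact hC (w n) (hw n).1 (hw n).2
  have hPmem : ∀ n, MemLp (P n) p₅ μ := fun n => by
    refine ⟨(hPc n).aestronglyMeasurable, (hPbound n).trans_lt ?_⟩
    refine ENNReal.mul_lt_top ENNReal.coe_lt_top (ENNReal.pow_lt_top ?_)
    exact ((hwn n).trans_lt (ENNReal.add_lt_top.2 ⟨ENNReal.one_lt_top, hUnorm.lt_top⟩))
  -- §3 + §6: `Pₙ` is Cauchy in `L^{5/3}(μ)`
  set B : ℝ≥0∞ := (2 * (1 + eLpNorm U p₁₀ μ)) ^ 2 with hB_def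
  have hBtop : B ≠ ⊤ := ENNReal.pow_ne_top (ENNReal.mul_ne_top (by norm_num)
    (ENNReal.add_ne_top.2 ⟨ENNReal.one_ne_top, hUnorm⟩))
  have hD : ∀ t : ℝ, 0 < t → ∀ n m, eLpNorm (P n - P m) p₅ μ ≤
      4 * C * (ENNReal.ofReal (t ^ 2) * (eLpNorm (w n - U) p₁₀ μ + eLpNorm (w m - U) p₁₀ μ) ^ 2 +
        ENNReal.ofReal (t⁻¹ ^ 2) * B) := by
    intro t ht n m
    have hbil := eLpNorm_normalisedPressure_sub_le (μ := μ) (p := p₅) (C := C) hC hp₅1' (hw n).1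
      (hw n).2 (hw m).1 (hw m).2 ht
    refine hbil.trans ?_
    rw [eLpNorm_norm_sq_eq, eLpNorm_norm_sq_eq, hB_def]
    gcongr
    · -- `‖wₙ − wₘ‖ ≤ ‖wₙ − U‖ + ‖wₘ − U‖`
      have e : w n - w m = (w n - U) + (U - w m) := by abel
      calc eLpNorm (w n - w m) p₁₀ μ = eLpNorm ((w n - U) + (U - w m)) p₁₀ μ := by rw [← e]
        _ ≤ eLpNorm (w n - U) p₁₀ μ + eLpNorm (U - w m) p₁₀ μ :=
            eLpNorm_add_le ((hwc n).aestronglyMeasurable.sub hUm) (hUm.sub (hwc m).aestronglyMeasurable) hp₁₀1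
        _ = eLpNorm (w n - U) p₁₀ μ + eLpNorm (w m - U) p₁₀ μ := by rw [eLpNorm_sub_comm U]
    · -- `‖wₙ + wₘ‖ ≤ 2 (1 + ‖U‖)`
      calc eLpNorm (w n + w m) p₁₀ μ ≤ eLpNorm (w n) p₁₀ μ + eLpNorm (w m) p₁₀ μ :=
            eLpNorm_add_le (hwc n).aestronglyMeasurable (hwc m).aestronglyMeasurable hp₁₀1
        _ ≤ (1 + eLpNorm U p₁₀ μ) + (1 + eLpNorm U p₁₀ μ) := add_le_add (hwn n) (hwn m)
        _ = 2 * (1 + eLpNorm U p₁₀ μ) := by rw [two_mul]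
  have hA : (4 : ℝ≥0∞) * C ≠ ⊤ := ENNReal.mul_ne_top (by norm_num) ENNReal.coe_ne_top
  have hCauchy := cauchy_of_quadratic_bound hA hBtop hT hD
  obtain ⟨Q, hQmem, hE⟩ := exists_memLp_tendsto_eLpNorm_sub_of_cauchy hp₅1' hPmem hCauchy
  -- the witness
  have hQm : AEStronglyMeasurable Q volume := aestronglyMeasurable_of_withDensity hQmem.1
  refine ⟨Q, hQm, ?_, ?_⟩
  · -- the norm bound, passing to the limit
    have hwlim : Tendsto (fun n => eLpNorm (w n) p₁₀ μ) atTop (𝓝 (eLpNorm U p₁₀ μ)) :=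
      tendsto_eLpNorm_of_tendsto_eLpNorm_sub hp₁₀1 (fun n => (hwc n).aestronglyMeasurable) hUm hT
    have hstep : ∀ n, eLpNorm Q p₅ μ ≤ eLpNorm (P n - Q) p₅ μ + C * eLpNorm (w n) p₁₀ μ ^ 2 := by
      intro n
      have e : Q = (Q - P n) + P n := by abel
      calc eLpNorm Q p₅ μ = eLpNorm ((Q - P n) + P n) p₅ μ := by rw [← e]
        _ ≤ eLpNorm (Q - P n) p₅ μ + eLpNorm (P n) p₅ μ :=
            eLpNorm_add_le (hQmem.1.sub (hPc n).aestronglyMeasurable) (hPc n).aestronglyMeasurable hp₅1'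
        _ ≤ eLpNorm (P n - Q) p₅ μ + C * eLpNorm (w n) p₁₀ μ ^ 2 := by
            rw [eLpNorm_sub_comm]; exact add_le_add le_rfl (hPbound n)
    have hlim : Tendsto (fun n => eLpNorm (P n - Q) p₅ μ + C * eLpNorm (w n) p₁₀ μ ^ 2) atTop
        (𝓝 (0 + C * eLpNorm U p₁₀ μ ^ 2)) :=
      hE.add (ENNReal.Tendsto.const_mul (((ENNReal.continuous_pow 2).tendsto _).comp hwlim)
        (Or.inr ENNReal.coe_ne_top))
    have hQle : eLpNorm Q p₅ μ ≤ C * eLpNorm U p₁₀ μ ^ 2 := by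
      have h := le_of_tendsto_of_tendsto' tendsto_const_nhds hlim hstep
      rwa [zero_add] at h
    -- unfold into weighted Lebesgue integrals and raise to the power `5/3`
    rw [hconvQ, hconvU] at hQle
    have h53 := ENNReal.rpow_le_rpow hQle (by norm_num : (0 : ℝ) ≤ 5 / 3)
    rw [← ENNReal.rpow_mul, show (1 / (5 / 3 : ℝ)) * (5 / 3) = 1 by norm_num, ENNReal.rpow_one,
      ENNReal.mul_rpow_of_nonneg _ _ (by norm_num : (0 : ℝ) ≤ 5 / 3), ← ENNReal.rpow_natCast,
      ← ENNReal.rpow_mul, ← ENNReal.rpow_mul,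
      show (1 / (10 / 3 : ℝ)) * (((2 : ℕ) : ℝ) * (5 / 3)) = 1 by norm_num, ENNReal.rpow_one,
      ← ENNReal.coe_rpow_of_nonneg _ (by norm_num : (0 : ℝ) ≤ 5 / 3)] at h53
    exact h53
  · -- the distributional equation, passing to the limit in both pairings
    intro φ hφ hφc
    have hφ2 : ContDiff ℝ 2 φ := contDiff_infty.1 hφ 2
    have hΔc : Continuous (Δ φ) := FluidPDE.continuous_laplacian hφ2
    have hΔs : HasCompactSupport (Δ φ) :=
      hφc.mono' fun x hx => by
        contrapose! hx
        simp [FluidPDE.laplacian_eq_zero_of_notMem_tsupport hx]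
    -- finiteness and decay of `∫ |Pₙ − Q|^{5/3} w`
    have hI_eq : ∀ n, ∫⁻ y, ‖P n y - Q y‖ₑ ^ (5 / 3 : ℝ) * ‖y‖ₑ ^ (-(5 / 3) : ℝ) =
        eLpNorm (P n - Q) p₅ μ ^ (5 / 3 : ℝ) := fun n => by
      rw [hconvQ, ← ENNReal.rpow_mul, show (1 / (5 / 3 : ℝ)) * (5 / 3) = 1 by norm_num,
        ENNReal.rpow_one]
      rfl
    have hfin : ∀ n, ∫⁻ y, ‖P n y - Q y‖ₑ ^ (5 / 3 : ℝ) * ‖y‖ₑ ^ (-(5 / 3) : ℝ) ≠ ⊤ := fun n => by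
      rw [hI_eq]
      exact ENNReal.rpow_ne_top_of_nonneg (by norm_num) ((hPmem n).sub hQmem).eLpNorm_ne_top
    have hElim : Tendsto (fun n => ∫⁻ y, ‖P n y - Q y‖ₑ ^ (5 / 3 : ℝ) * ‖y‖ₑ ^ (-(5 / 3) : ℝ))
        atTop (𝓝 0) := by
      simp_rw [hI_eq]
      have h := ((ENNReal.continuous_rpow_const (y := (5 / 3 : ℝ))).tendsto 0).comp hE
      rwa [ENNReal.zero_rpow_of_pos (by norm_num)] at h
    -- integrability of the pairings
    have hPi : ∀ n, Integrable fun x => P n x * (Δ φ) x := fun n =>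
      ((hPc n).mul hΔc).integrable_of_hasCompactSupport hΔs.mul_left
    have hIQ : ∫⁻ y, ‖Q y‖ₑ ^ (5 / 3 : ℝ) * ‖y‖ₑ ^ (-(5 / 3) : ℝ) ≠ ⊤ := by
      have h := hQmem.eLpNorm_ne_top
      rw [hconvQ] at h
      exact fun h' => h (by rw [h']; exact ENNReal.top_rpow_of_pos (by norm_num))
    have hQl : LocallyIntegrable Q volume :=
      locallyIntegrable_of_weighted hQm (⟨by norm_num, by norm_num, by norm_num⟩ :
        (5 / 3 : ℝ).HolderConjugate (5 / 2)) (by norm_num : (0 : ℝ) < 5 / 3) hIQ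
    have hQi : Integrable fun x => Q x * (Δ φ) x := by
      simpa only [smul_eq_mul] using hQl.integrable_smul_right_of_hasCompactSupport hΔc hΔs
    -- the two limits
    have h1 : Tendsto (fun n => ∫ x, P n x * (Δ φ) x) atTop (𝓝 (∫ x, Q x * (Δ φ) x)) :=
      tendsto_integral_mul_of_tendsto_weighted (fun n => (hPc n).aestronglyMeasurable) hQm hfin hElim
        hΔc hΔs hPi hQi
    have h2 : Tendsto (fun n => ∫ x, P n x * (Δ φ) x) atTop
        (𝓝 (-∫ x, fderiv ℝ (fderiv ℝ φ) x (U x) (U x))) := by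
      have h := (tendsto_integral_hessian_apply hwc hUc hT hUnorm hφ hφc).neg
      refine h.congr fun n => ?_
      exact (integral_normalisedPressure_mul_laplacian_eq_neg (hw n).1 (hw n).2 hφ hφc).symm
    exact tendsto_nhds_unique h1 h2

/-- **The full reduction of Tsai's weighted `L^{5/3}` pressure bound to `A_p` theory**:
`tsai1998_pressure_L53w` (Tsai 1998, §4 pp. 45–46) follows from the power-weighted
Calderón–Zygmund bound for the Riesz-type kernels of the normalised pressure on test fields
(`grafakos2014_normalisedPressure_powerWeight_bound`; Stein 1993 Ch. V §4.2/§6.4 = Tsai's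
[St2, pp. 204–211]) — this file's `tsai1998_weightedRieszPressure_of_powerWeight` composed with
`tsai1998_pressure_L53w_of_weightedRiesz` of `FluidPDE/TsaiSelfSimilarPressureProofs`.
[cite: Tsai1998, §4 pp. 45–46 (construction of P̃ before Lemma 4.1)] -/
theorem tsai1998_pressure_L53w_of_powerWeight (h : grafakos2014_normalisedPressure_powerWeight_bound) :
    tsai1998_pressure_L53w :=
  tsai1998_pressure_L53w_of_weightedRiesz (tsai1998_weightedRieszPressure_of_powerWeight h)

/-! ### The discharges (the `A_p` input is now proved: `NormalisedPressurePowerWeightBoundProofs`) -/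

/-- **Discharge of `tsai1998_weightedRieszPressure`** (Tsai 1998, §4 p. 45: for continuous `U`
with `∫ |U|^{10/3}|y|^{-5/3} < ∞` there is `P̃ ∈ L^{5/3}(|y|^{-5/3} dy)`,
`∫ |P̃|^{5/3}|y|^{-5/3} ≤ C ∫ |U|^{10/3}|y|^{-5/3}`, solving `−ΔP̃ = ∂ᵢ∂ⱼ(UᵢUⱼ)` in `𝒟'(ℝ³)`):
this file's extension argument `tsai1998_weightedRieszPressure_of_powerWeight` fed with the
proved power-weighted Calderón–Zygmund bound
`grafakos2014_normalisedPressure_powerWeight_bound_holds` (E. M. Stein's 1957 power-weight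
theorem on top of the tree's Calderón–Zygmund `L^p` theory, `FluidPDE/NormalisedPressurePowerWeightBoundProofs`,
`SingularIntegrals/SteinPowerWeights`). Unconditional. [cite: Tsai1998, §4 p. 45 (construction of P̃; [St2, pp. 204–211])] -/
theorem tsai1998_weightedRieszPressure_holds : tsai1998_weightedRieszPressure :=
  tsai1998_weightedRieszPressure_of_powerWeight grafakos2014_normalisedPressure_powerWeight_bound_holds

/-- **Discharge of `tsai1998_pressure_L53w`** (Tsai 1998, §4 pp. 45–46, the profile pressure of
a self-similar solution with local energy estimates lies in `L^{5/3}_w`, `w = |y|^{-5/3}`, up to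
a constant): `tsai1998_pressure_L53w_of_powerWeight` fed with
`grafakos2014_normalisedPressure_powerWeight_bound_holds`. Unconditional.
[cite: Tsai1998, §4 pp. 45–46 (construction of P̃ before Lemma 4.1)] -/
theorem tsai1998_pressure_L53w_holds : tsai1998_pressure_L53w :=
  tsai1998_pressure_L53w_of_powerWeight grafakos2014_normalisedPressure_powerWeight_bound_holds

end Assembly

end Literature.Analysis.FluidPDE

end
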